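import Literature.NumberTheory.Sieve.MatomakiRadziwillLemma3Halasz
import Literature.NumberTheory.Sieve.RankinComposedTail
import Literature.NumberTheory.Sieve.MatomakiRadziwillLemma13
import Literature.NumberTheory.Sieve.MatomakiRadziwillProp1Inputs
import Mathlib.NumberTheory.Harmonic.Bounds
import HarnessLib

/-!
# Matomäki–Radziwiłł 2016, Lemma 3 — discharged from Granville–Soundararajan's Theorem 1 and Ford's bound

Topic `Literature/NumberTheory/Sieve`.  Everything in this file is PROVED; the two remaining named inputs are
passed as hypotheses of the final theorem:

* `MatomakiRadziwill2016_lemma3_of_GS_ford :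
    GranvilleSoundararajan2003_theorem1 → zeta_bound_ford → MatomakiRadziwill2016_lemma3`.

Here `MatomakiRadziwill2016_lemma3` (`MatomakiRadziwillProp1Inputs.lean`) is Lemma 3 of K. Matomäki,
M. Radziwiłł, *Multiplicative functions in short intervals*, Ann. of Math. 183 (2016), §2, as printed: for
`X ≥ Q ≥ P ≥ 2`, real multiplicative `|f| ≤ 1`, `R(s) = ∑_{X ≤ n ≤ 2X} f(n) n^{-s}/(#{p ∈ [P,Q] : p ∣ n} + 1)`
and `t ∈ [(log X)^{1/16}, X^A]`,
`|R(1+it)| ≪_A (log Q)/((log X)^{1/16} log P) + log X · exp(−(log X)/(3 log Q) · log((log X)/(log Q)))`;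
`GranvilleSoundararajan2003_theorem1` is the sharp Halász theorem (Canad. J. Math. 55 (2003), Thm 1) and
`zeta_bound_ford` is Ford's Richert-type bound for `ζ` (Proc. LMS 85 (2002), Thm 1), through which MR's
Lemma 2 was obtained in `PretentiousDistanceFord.lean`.

## The proof (MR §2, proof of Lemma 3, made quantitative)

"Splitting `n = n₁n₂` where `n₁` has all prime factors from `[P, Q]` and `n₂` has none":
`n₁ = s_S(n)` is the `S`-part (`MatomakiRadziwillL13.sPart`, `S = 𝒫 ∩ [P, Q]` = `primesPQ`), the weight
`1/(ω + 1)` depends on `n₁` only, `f(n) = f(n₁) f(n₂)`, and the fibre of `n₁` in `[X, 2X]` is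
`n₁ · {⌈X/n₁⌉ ≤ m ≤ ⌊2X/n₁⌋, m S-free}` (`sum_fiber_eq`).

1. `n₁ ≤ X^{3/4}` (`first_part_le`, `first_part_numeric`): on each fibre the inner sum is a logarithmically
   weighted short sum of the sifted twist `G = f·1_{S-free}·n^{-it}` of length `≥ X^{1/4}`, bounded by MR's
   Lemma 1 (`MatomakiRadziwillL3.norm_sum_Icc_div_le`, from GS Theorem 1, `T = t/4`) with the distance lower
   bound `M₀ = ¼((log log Y_*)/3 − C_D) + ½ ∑_{p ∈ S, p ≤ Y_*} 1/p`, `Y_* = X^{1/4}/2`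
   (`Msum_siftedTwist_ge` + MR Lemma 2 `PretentiousFord.pretentiousDistSq_one_twist_ge` at `τ = 2(t+y)`);
   the sum over `n₁` costs `∏_{p ∈ S}(1 − 1/p)⁻¹ ≤ e^{C} log Q/log P` (Rankin file), of which the power
   `39/80` is recovered by the sifting gain in `M₀` (Mertens on `[P, min(Q, Y_*)]`), leaving
   `≪ (log Q/log P)^{41/80} (log X)^{-13/160} + (log Q/log P)((log X)^{-1/16} + log log X/ log X)
    ≪ T₁ = log Q/((log X)^{1/16} log P)` (`termA_le`, `termB_le`, `termC_le`; `13/160 > 1/16`).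
2. `n₁ > X^{3/4}` (`second_part_numeric`): `≤ ∑ 1/n ≤ 2` trivially; this suffices unless
   `T₂ = log X · e^{-(u/3) log u} < 1` (`u = log X/log Q`), in which case Rankin's trick over `S`-composed
   `n₁ > X^{3/4}` (`RankinComposed.sum_inv_le_rankin`, `prod_inv_le_exp`, `sum_excess_le`) with
   `η = log u/log Q` gives `≪ T₂` when `u ≤ Q^{2/5}` (`second_b1`), and with `η = 2/5` gives
   `≪ (log X)^{-1/16} ≤ T₁` when `u > Q^{2/5}` (`second_b2i`: `Q < e^{400}`; `second_b2ii`: `Q ≥ e^{400}`).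
3. Small `X` (below an explicit `X₀(A, x₀)`): `|R| ≤ 2 ≤ 2 (log X₀)^{1/16} T₁`.

All constants are explicit but astronomically large (e.g. `e^{24 e^{288}}`, `e^{e^{400}}`, `X₀ ≥ e^{4¹⁶}`);
only their existence matters (`∃ C`).

## References
* K. Matomäki, M. Radziwiłł, Ann. of Math. (2) 183 (2016) (arXiv:1501.04585), §2, Lemmas 1–3.
  [cite: MatomakiRadziwillAnnals2016, Lemma 3]
* A. Granville, K. Soundararajan, Canad. J. Math. 55 (2003), Theorem 1. [cite: GranvilleSoundararajan2003, Theorem 1]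
* K. Ford, Proc. London Math. Soc. 85 (2002), Theorem 1. [cite: Ford2002, Theorem 1]
-/

noncomputable section

open Finset Real Complex
open Literature.NumberTheory.LFunctions.GranvilleSoundararajan
open Literature.NumberTheory.Sieve.MatomakiRadziwillL4A

namespace Literature.NumberTheory.Sieve

namespace MatomakiRadziwillL3

open MatomakiRadziwillL13 (sPart sPart_pos sPart_dvd primeFactors_sPart_subset sPart_mem_factoredNumbers
  dvd_sPart_of_dvd sPart_le)

/-! ### The splitting `n = n₁ n₂`: `n₁ = s_S(n)` the `S`-part, `n₂ = n / s_S(n)` free of primes of `S` -/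

/-- `S`-free: no prime of `S` divides `m`. [folklore] -/
def SFree (S : Finset ℕ) (m : ℕ) : Prop := ∀ p ∈ S, ¬ p ∣ m

/-- The cofactor `n / s_S(n)` is `S`-free (`n ≠ 0`). [folklore] -/
theorem sFree_div_sPart {S : Finset ℕ} (hS : ∀ p ∈ S, p.Prime) {n : ℕ} (hn : n ≠ 0) :
    SFree S (n / sPart S n) := by
  intro p hp hdvd
  have hsd := sPart_dvd hS n
  set m := n / sPart S n with hm
  have hnm : n = sPart S n * m := (Nat.mul_div_cancel' hsd).symm
  -- `p * s_S(n)` is `S`-factored and divides `n`, hence divides `s_S(n)`: absurd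
  have h1 : p * sPart S n ∣ n := by
    have : sPart S n * p ∣ sPart S n * m := Nat.mul_dvd_mul_left _ hdvd
    rw [← hnm, mul_comm] at this; exact this
  have h2 : (p * sPart S n).primeFactors ⊆ S := by
    rw [Nat.primeFactors_mul (hS p hp).ne_zero (sPart_pos hS n).ne', (hS p hp).primeFactors]
    exact Finset.union_subset (Finset.singleton_subset_iff.2 hp) (primeFactors_sPart_subset hS n)
  have h3 : p * sPart S n ∣ sPart S n := dvd_sPart_of_dvd hn h1 h2
  have h4 : p * sPart S n ≤ sPart S n := Nat.le_of_dvd (sPart_pos hS n) h3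
  have h5 : 2 ≤ p := (hS p hp).two_le
  have := sPart_pos hS n
  nlinarith

/-- An `S`-factored number and an `S`-free number are coprime. [folklore] -/
theorem coprime_of_factored_of_sFree {S : Finset ℕ} {a m : ℕ} (ha : a ∈ Nat.factoredNumbers S)
    (hm : SFree S m) : Nat.Coprime a m := by
  rw [Nat.mem_factoredNumbers_iff_primeFactors_subset] at ha
  refine Nat.coprime_of_dvd fun k hk hka hkm => ?_
  have hkS : k ∈ S := ha.2 (Nat.mem_primeFactors.2 ⟨hk, hka, ha.1⟩)
  exact hm k hkS hkm

/-- For `a` `S`-factored and `m` `S`-free, `s_S(a m) = a`. [folklore] -/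
theorem sPart_mul_eq {S : Finset ℕ} (hS : ∀ p ∈ S, p.Prime) {a m : ℕ} (ha : a ∈ Nat.factoredNumbers S)
    (hm : SFree S m) (hm0 : m ≠ 0) : sPart S (a * m) = a := by
  have ha0 : a ≠ 0 := (Nat.mem_factoredNumbers_iff_primeFactors_subset.1 ha).1
  have hn0 : a * m ≠ 0 := mul_ne_zero ha0 hm0
  refine Nat.dvd_antisymm ?_ ?_
  · -- `s_S(am) ∣ am` and `s_S(am)` is coprime to `m`
    have h1 : sPart S (a * m) ∣ a * m := sPart_dvd hS _
    have h2 : Nat.Coprime (sPart S (a * m)) m :=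
      coprime_of_factored_of_sFree (sPart_mem_factoredNumbers hS _) hm
    exact h2.dvd_of_dvd_mul_right h1
  · exact dvd_sPart_of_dvd hn0 (Dvd.intro m rfl) (Nat.mem_factoredNumbers_iff_primeFactors_subset.1 ha).2

/-- If `s_S(n) = a` and `n = a m` then `m` is `S`-free (`n ≠ 0`). [folklore] -/
theorem sFree_of_sPart_eq {S : Finset ℕ} (hS : ∀ p ∈ S, p.Prime) {n a m : ℕ} (hn : n ≠ 0)
    (hnam : n = a * m) (hsa : sPart S n = a) : SFree S m := by
  have ha0 : a ≠ 0 := by rintro rfl; exact hn (by rw [hnam, zero_mul])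
  have hm : m = n / sPart S n := by rw [hsa, hnam, Nat.mul_div_cancel_left _ (Nat.pos_of_ne_zero ha0)]
  rw [hm]; exact sFree_div_sPart hS hn

/-- `1_S(m) = 1` for `S`-free `m ≠ 0`, and `= 0` otherwise (`m ≠ 0`). [folklore] -/
theorem sieveInd_of_sFree {S : Finset ℕ} {m : ℕ} (hm0 : m ≠ 0) (hm : SFree S m) : sieveInd S m = 1 := by
  rw [sieveInd_apply, if_neg hm0, if_neg]
  rintro ⟨p, hp, h⟩; exact hm p hp h

/-- `sieveInd_of_not_sFree` (elementary). [folklore] -/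
theorem sieveInd_of_not_sFree {S : Finset ℕ} {m : ℕ} (hm : ¬ SFree S m) : sieveInd S m = 0 := by
  rw [sieveInd_apply]
  split_ifs with h0 h1
  · rfl
  · rfl
  · exact absurd (fun p hp hpm => h1 ⟨p, hp, hpm⟩) hm

/-- The primes of `S` dividing `n` are those dividing `s_S(n)` (`n ≠ 0`). [folklore] -/
theorem dvd_iff_dvd_sPart {S : Finset ℕ} (hS : ∀ p ∈ S, p.Prime) {n : ℕ} (hn : n ≠ 0) {p : ℕ} (hp : p ∈ S) :
    p ∣ n ↔ p ∣ sPart S n := by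
  constructor
  · intro h
    exact dvd_sPart_of_dvd hn h (by rw [(hS p hp).primeFactors]; exact Finset.singleton_subset_iff.2 hp)
  · intro h; exact h.trans (sPart_dvd hS n)

/-- The multiples of `d ≥ 1` in `[L, U]`, divided by `d`, form the interval `[⌈L/d⌉, ⌊U/d⌋]`. [folklore] -/
theorem image_div_eq_Icc {d : ℕ} (hd : 1 ≤ d) (L U : ℕ) :
    ((Finset.Icc L U).filter (d ∣ ·)).image (· / d) = Finset.Icc ((L + d - 1) / d) (U / d) := by
  ext m
  simp only [Finset.mem_image, Finset.mem_filter, Finset.mem_Icc]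
  have hd0 : 0 < d := hd
  constructor
  · rintro ⟨n, ⟨⟨hL, hU⟩, hdn⟩, rfl⟩
    obtain ⟨k, rfl⟩ := hdn
    rw [Nat.mul_div_cancel_left _ hd0]
    refine ⟨?_, (Nat.le_div_iff_mul_le hd0).2 (by rw [mul_comm]; exact hU)⟩
    rw [Nat.div_le_iff_le_mul_add_pred hd0]
    set q := d * k with hq
    omega
  · rintro ⟨h1, h2⟩
    refine ⟨d * m, ⟨⟨?_, ?_⟩, Dvd.intro m rfl⟩, by rw [Nat.mul_div_cancel_left _ hd0]⟩
    · rw [Nat.div_le_iff_le_mul_add_pred hd0] at h1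
      set q := d * m with hq
      omega
    · have := (Nat.le_div_iff_mul_le hd0).1 h2
      rw [mul_comm] at this; exact this

end MatomakiRadziwillL3

end Literature.NumberTheory.Sieve

namespace Literature.NumberTheory.Sieve

namespace MatomakiRadziwillL3

open MatomakiRadziwillL13 (sPart sPart_pos sPart_dvd primeFactors_sPart_subset sPart_mem_factoredNumbers
  dvd_sPart_of_dvd sPart_le)

/-! ### The summand of `R(1+it)` and its factorisation along `n = n₁ n₂` -/

/-- The set of primes `S = 𝒫 ∩ [P, Q]` of Lemma 3. [cite: MatomakiRadziwillAnnals2016, Lemma 3] -/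
def primesPQ (P Q : ℝ) : Finset ℕ := (Finset.Icc ⌈P⌉₊ ⌊Q⌋₊).filter Nat.Prime

/-- The elements of `primesPQ` are prime. [folklore] -/
theorem primesPQ_prime {P Q : ℝ} : ∀ p ∈ primesPQ P Q, p.Prime := fun _ hp => (Finset.mem_filter.1 hp).2

/-- The weight depends only on the `S`-part: `ω(n; P, Q) = ω(s_S(n); P, Q)`. [folklore] -/
theorem primeDivisorsIn_sPart (P Q : ℝ) {n : ℕ} (hn : n ≠ 0) :
    primeDivisorsIn P Q (sPart (primesPQ P Q) n) = primeDivisorsIn P Q n := by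
  unfold primeDivisorsIn
  congr 1
  refine Finset.filter_congr fun p hp => ?_
  constructor
  · rintro ⟨hpp, h⟩; exact ⟨hpp, h.trans (sPart_dvd primesPQ_prime n)⟩
  · rintro ⟨hpp, h⟩
    exact ⟨hpp, (dvd_iff_dvd_sPart primesPQ_prime hn (Finset.mem_filter.2 ⟨hp, hpp⟩)).1 h⟩

/-- The summand `F(n) = f(n) n^{-(1+it)} / (ω(n; P, Q) + 1)` of `R(1 + it)`. [cite: MatomakiRadziwillAnnals2016, Lemma 3] -/
def summandR (f : ArithmeticFunction ℝ) (P Q t : ℝ) (n : ℕ) : ℂ :=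
  (f n : ℂ) * (n : ℂ) ^ (-(1 + (t : ℂ) * I)) / ((primeDivisorsIn P Q n : ℂ) + 1)

/-- `‖F(n)‖ ≤ 1/n` for `|f| ≤ 1`, `n ≥ 1`. [folklore] -/
theorem norm_summandR_le {f : ArithmeticFunction ℝ} (hf : ∀ n, |f n| ≤ 1) (P Q t : ℝ) {n : ℕ} (hn : 1 ≤ n) :
    ‖summandR f P Q t n‖ ≤ 1 / n := by
  have hn0 : (0 : ℝ) < n := by exact_mod_cast hn
  rw [summandR, norm_div, norm_mul, Complex.norm_real, Real.norm_eq_abs]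
  have h1 : ‖(n : ℂ) ^ (-(1 + (t : ℂ) * I))‖ = 1 / n := by
    rw [Complex.norm_natCast_cpow_of_pos (by omega)]; simp [Real.rpow_neg_one]
  have h2 : (1 : ℝ) ≤ ‖((primeDivisorsIn P Q n : ℂ) + 1)‖ := by
    have : ((primeDivisorsIn P Q n : ℂ) + 1) = ((primeDivisorsIn P Q n + 1 : ℕ) : ℂ) := by push_cast; ring
    rw [this, Complex.norm_natCast]; exact_mod_cast Nat.le_add_left 1 _
  rw [h1, div_le_iff₀ (by linarith)]
  calc |f n| * (1 / n) ≤ 1 * (1 / n) := mul_le_mul_of_nonneg_right (hf n) (by positivity)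
    _ ≤ 1 / n * ‖((primeDivisorsIn P Q n : ℂ) + 1)‖ := by rw [one_mul]; nlinarith [show 0 < 1 / (n:ℝ) by positivity]

/-- The `n₁`-weight `w(n₁) = f(n₁) n₁^{-(1+it)}/(ω(n₁)+1) = F(n₁)`, of norm `≤ 1/n₁`. [folklore] -/
abbrev wR (f : ArithmeticFunction ℝ) (P Q t : ℝ) (n₁ : ℕ) : ℂ := summandR f P Q t n₁

/-- **The factorisation of the summand**: for `n₁` `S`-factored (`S = 𝒫 ∩ [P,Q]`), `n₁ ∣ n`, `n ≠ 0`,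
`1_{s_S(n) = n₁} F(n) = w(n₁) · G(n/n₁)/(n/n₁)` with `G = siftedTwist f S t`. [folklore] -/
theorem summandR_fiber {f : ArithmeticFunction ℝ} (hf : f.IsMultiplicative) (P Q t : ℝ) {n₁ n : ℕ}
    (hn₁ : n₁ ∈ Nat.factoredNumbers (primesPQ P Q)) (hdvd : n₁ ∣ n) (hn : n ≠ 0) :
    (if sPart (primesPQ P Q) n = n₁ then summandR f P Q t n else 0) =
      wR f P Q t n₁ * (siftedTwist f (primesPQ P Q) t (n / n₁) / (n / n₁ : ℕ)) := by
  set S := primesPQ P Q with hSdef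
  have hS : ∀ p ∈ S, p.Prime := primesPQ_prime
  obtain ⟨m, rfl⟩ := hdvd
  have hn₁0 : n₁ ≠ 0 := (Nat.mem_factoredNumbers_iff_primeFactors_subset.1 hn₁).1
  have hm0 : m ≠ 0 := fun h => hn (by rw [h, mul_zero])
  have hn₁pos : 0 < n₁ := Nat.pos_of_ne_zero hn₁0
  rw [Nat.mul_div_cancel_left m hn₁pos]
  by_cases hfree : SFree S m
  · -- `s_S(n₁ m) = n₁`, `G(m) = f(m) m^{-it}`, `f(n₁ m) = f(n₁) f(m)`, `ω(n₁ m) = ω(n₁)`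
    have hsp : sPart S (n₁ * m) = n₁ := sPart_mul_eq hS hn₁ hfree hm0
    rw [if_pos hsp, siftedTwist_apply, sieveInd_of_sFree hm0 hfree, mul_one]
    have hcop : Nat.Coprime n₁ m := coprime_of_factored_of_sFree hn₁ hfree
    have hω : primeDivisorsIn P Q (n₁ * m) = primeDivisorsIn P Q n₁ := by
      rw [← primeDivisorsIn_sPart P Q hn, ← hSdef, hsp]
    rw [summandR, wR, summandR, hω, hf.map_mul_of_coprime hcop, Nat.cast_mul, Complex.natCast_mul_natCast_cpow]
    have hm0' : (m : ℂ) ≠ 0 := by exact_mod_cast hm0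
    have hn₁0' : (n₁ : ℂ) ≠ 0 := by exact_mod_cast hn₁0
    have hω0 : ((primeDivisorsIn P Q n₁ : ℂ) + 1) ≠ 0 := by
      have : ((primeDivisorsIn P Q n₁ : ℂ) + 1) = ((primeDivisorsIn P Q n₁ + 1 : ℕ) : ℂ) := by push_cast; ring
      rw [this]; exact_mod_cast Nat.succ_ne_zero (primeDivisorsIn P Q n₁)
    have e : (m : ℂ) ^ (-(1 + (t : ℂ) * I)) = (m : ℂ)⁻¹ * (m : ℂ) ^ (-((t : ℂ) * I)) := by
      rw [neg_add, Complex.cpow_add _ _ hm0', Complex.cpow_neg_one]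
    rw [e]; push_cast
    field_simp
  · -- `m` not `S`-free: both sides vanish
    have hG : siftedTwist f S t m = 0 := by
      rw [siftedTwist_apply, sieveInd_of_not_sFree hfree]; simp
    rw [hG, zero_div, mul_zero, if_neg]
    intro hsp
    exact hfree (sFree_of_sPart_eq hS hn rfl hsp)

/-- **The fibre over `n₁`** of `n ↦ s_S(n)` in `[L, U]`, summed: for `n₁` `S`-factored,
`∑_{L ≤ n ≤ U, s_S(n) = n₁} F(n) = w(n₁) ∑_{⌈L/n₁⌉ ≤ m ≤ ⌊U/n₁⌋} G(m)/m`. [folklore] -/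
theorem sum_fiber_eq {f : ArithmeticFunction ℝ} (hf : f.IsMultiplicative) (P Q t : ℝ) {n₁ : ℕ}
    (hn₁ : n₁ ∈ Nat.factoredNumbers (primesPQ P Q)) {L U : ℕ} (hL : 1 ≤ L) :
    ∑ n ∈ (Finset.Icc L U).filter (fun n => sPart (primesPQ P Q) n = n₁), summandR f P Q t n =
      wR f P Q t n₁ * ∑ m ∈ Finset.Icc ((L + n₁ - 1) / n₁) (U / n₁),
        siftedTwist f (primesPQ P Q) t m / m := by
  classical
  set S := primesPQ P Q with hSdef
  have hS : ∀ p ∈ S, p.Prime := primesPQ_prime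
  have hn₁0 : n₁ ≠ 0 := (Nat.mem_factoredNumbers_iff_primeFactors_subset.1 hn₁).1
  have hn₁1 : 1 ≤ n₁ := Nat.one_le_iff_ne_zero.2 hn₁0
  -- pass to the multiples of `n₁`
  have step1 : ∑ n ∈ (Finset.Icc L U).filter (fun n => sPart S n = n₁), summandR f P Q t n =
      ∑ n ∈ (Finset.Icc L U).filter (n₁ ∣ ·), (if sPart S n = n₁ then summandR f P Q t n else 0) := by
    rw [Finset.sum_filter, Finset.sum_filter]
    refine Finset.sum_congr rfl fun n _ => ?_
    by_cases h : sPart S n = n₁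
    · rw [if_pos h, if_pos (h ▸ sPart_dvd hS n)]
    · rw [if_neg h]; split_ifs <;> rfl
  have step2 : ∑ n ∈ (Finset.Icc L U).filter (n₁ ∣ ·), (if sPart S n = n₁ then summandR f P Q t n else 0) =
      ∑ n ∈ (Finset.Icc L U).filter (n₁ ∣ ·), wR f P Q t n₁ * (siftedTwist f S t (n / n₁) / (n / n₁ : ℕ)) := by
    refine Finset.sum_congr rfl fun n hn => ?_
    rw [Finset.mem_filter, Finset.mem_Icc] at hn
    exact summandR_fiber hf P Q t hn₁ hn.2 (by omega)
  have step3 : ∑ n ∈ (Finset.Icc L U).filter (n₁ ∣ ·), wR f P Q t n₁ * (siftedTwist f S t (n / n₁) / (n / n₁ : ℕ)) =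
      ∑ m ∈ ((Finset.Icc L U).filter (n₁ ∣ ·)).image (· / n₁), wR f P Q t n₁ * (siftedTwist f S t m / m) := by
    rw [Finset.sum_image]
    intro a ha b hb hab
    rw [Finset.mem_coe, Finset.mem_filter] at ha hb
    obtain ⟨ka, hka⟩ := ha.2; obtain ⟨kb, hkb⟩ := hb.2
    simp only at hab
    rw [hka, hkb, Nat.mul_div_cancel_left _ (by omega), Nat.mul_div_cancel_left _ (by omega)] at hab
    rw [hka, hkb, hab]
  rw [step1, step2, step3, image_div_eq_Icc hn₁1, ← Finset.mul_sum]

/-- `‖w(n₁)‖ ≤ 1/n₁`. [folklore] -/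
theorem norm_wR_le {f : ArithmeticFunction ℝ} (hf : ∀ n, |f n| ≤ 1) (P Q t : ℝ) {n₁ : ℕ} (hn₁ : 1 ≤ n₁) :
    ‖wR f P Q t n₁‖ ≤ 1 / n₁ := norm_summandR_le hf P Q t hn₁

/-- **The first part of `R`**, after the fibre decomposition:
`‖∑_{L ≤ n ≤ U, s_S(n) ≤ Z} F(n)‖ ≤ ∑_{n₁ ≤ Z, S-factored} (1/n₁) ‖∑_{⌈L/n₁⌉ ≤ m ≤ ⌊U/n₁⌋} G(m)/m‖`.
[cite: MatomakiRadziwillAnnals2016, Lemma 3 (proof, first term)] -/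
theorem norm_sum_small_sPart_le {f : ArithmeticFunction ℝ} (hf : f.IsMultiplicative) (hf1 : ∀ n, |f n| ≤ 1)
    (P Q t : ℝ) {L U Zn : ℕ} (hL : 1 ≤ L) :
    ‖∑ n ∈ (Finset.Icc L U).filter (fun n => sPart (primesPQ P Q) n ≤ Zn), summandR f P Q t n‖ ≤
      ∑ n₁ ∈ (Finset.Icc 1 Zn).filter (· ∈ Nat.factoredNumbers (primesPQ P Q)),
        (1 : ℝ) / n₁ * ‖∑ m ∈ Finset.Icc ((L + n₁ - 1) / n₁) (U / n₁), siftedTwist f (primesPQ P Q) t m / m‖ := by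
  classical
  set S := primesPQ P Q with hSdef
  have hS : ∀ p ∈ S, p.Prime := primesPQ_prime
  set N1 := (Finset.Icc 1 Zn).filter (· ∈ Nat.factoredNumbers S) with hN1
  have hmaps : ∀ n ∈ (Finset.Icc L U).filter (fun n => sPart S n ≤ Zn), sPart S n ∈ N1 := by
    intro n hn
    rw [Finset.mem_filter] at hn
    rw [hN1, Finset.mem_filter, Finset.mem_Icc]
    exact ⟨⟨sPart_pos hS n, hn.2⟩, sPart_mem_factoredNumbers hS n⟩
  rw [← Finset.sum_fiberwise_of_maps_to hmaps]
  refine (norm_sum_le _ _).trans (Finset.sum_le_sum fun n₁ hn₁ => ?_)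
  have hn₁' := (Finset.mem_filter.1 hn₁)
  have hn₁1 : 1 ≤ n₁ := (Finset.mem_Icc.1 hn₁'.1).1
  -- the fibre `{n : sPart n ≤ Zn ∧ sPart n = n₁} = {n : sPart n = n₁}` as `n₁ ≤ Zn`
  have hfib : ((Finset.Icc L U).filter (fun n => sPart S n ≤ Zn)).filter (fun n => sPart S n = n₁) =
      (Finset.Icc L U).filter (fun n => sPart S n = n₁) := by
    ext n; simp only [Finset.mem_filter]
    constructor
    · rintro ⟨⟨h1, -⟩, h2⟩; exact ⟨h1, h2⟩
    · rintro ⟨h1, h2⟩; exact ⟨⟨h1, h2 ▸ (Finset.mem_Icc.1 hn₁'.1).2⟩, h2⟩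
  rw [hfib, sum_fiber_eq hf P Q t hn₁'.2 hL, norm_mul]
  exact mul_le_mul_of_nonneg_right (norm_wR_le hf1 P Q t hn₁1) (norm_nonneg _)

/-! ### The second part: `n` with a large `S`-part -/

/-- **The large-`S`-part terms**: `‖∑_{L ≤ n ≤ U, s_S(n) > Z} F(n)‖ ≤ (∑_{n₂ ≤ U/(Z+1)} 1/n₂) · ∑_{Z < n₁ ≤ U, S-fact.} 1/n₁`
(injectivity of `n ↦ (s_S(n), n/s_S(n))`). [cite: MatomakiRadziwillAnnals2016, Lemma 3 (proof, second term)] -/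
theorem norm_sum_large_sPart_le {f : ArithmeticFunction ℝ} (hf1 : ∀ n, |f n| ≤ 1) (P Q t : ℝ)
    {L U Zn : ℕ} (hL : 1 ≤ L) :
    ‖∑ n ∈ (Finset.Icc L U).filter (fun n => Zn < sPart (primesPQ P Q) n), summandR f P Q t n‖ ≤
      (∑ n₂ ∈ Finset.Icc 1 (U / (Zn + 1)), (1 : ℝ) / n₂) *
        ∑ n₁ ∈ (Finset.Icc (Zn + 1) U).filter (· ∈ Nat.factoredNumbers (primesPQ P Q)), (1 : ℝ) / n₁ := by
  classical
  set S := primesPQ P Q with hSdef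
  have hS : ∀ p ∈ S, p.Prime := primesPQ_prime
  set B := (Finset.Icc L U).filter (fun n => Zn < sPart S n) with hB
  -- `‖∑ F‖ ≤ ∑ 1/n`
  have h1 : ‖∑ n ∈ B, summandR f P Q t n‖ ≤ ∑ n ∈ B, (1 : ℝ) / n := by
    refine (norm_sum_le _ _).trans (Finset.sum_le_sum fun n hn => ?_)
    have : 1 ≤ n := by have := (Finset.mem_Icc.1 (Finset.mem_filter.1 hn).1).1; omega
    exact norm_summandR_le hf1 P Q t this
  refine h1.trans ?_
  -- reindex by `n ↦ (s_S(n), n / s_S(n))`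
  set φ : ℕ → ℕ × ℕ := fun n => (sPart S n, n / sPart S n) with hφ
  set R1 := (Finset.Icc (Zn + 1) U).filter (· ∈ Nat.factoredNumbers S) with hR1
  set Tgt := R1 ×ˢ Finset.Icc 1 (U / (Zn + 1)) with hTgt
  have hmul : ∀ n, sPart S n * (n / sPart S n) = n := fun n => Nat.mul_div_cancel' (sPart_dvd hS n)
  have hmaps : ∀ n ∈ B, φ n ∈ Tgt := by
    intro n hn
    rw [hB, Finset.mem_filter, Finset.mem_Icc] at hn
    have hn0 : n ≠ 0 := by omega
    simp only [hTgt, hR1, hφ, Finset.mem_product, Finset.mem_filter, Finset.mem_Icc]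
    refine ⟨⟨⟨hn.2, (sPart_le hS hn0).trans hn.1.2⟩, sPart_mem_factoredNumbers hS n⟩, ?_, ?_⟩
    · exact Nat.pos_of_ne_zero fun h => hn0 (by rw [← hmul n, h, mul_zero])
    · calc n / sPart S n ≤ n / (Zn + 1) := Nat.div_le_div_left hn.2 (by omega)
        _ ≤ U / (Zn + 1) := Nat.div_le_div_right hn.1.2
  have hinj : Set.InjOn φ ↑B := by
    intro a _ b _ h
    have := congrArg (fun x : ℕ × ℕ => x.1 * x.2) h
    simpa only [hφ, hmul] using this
  have hval : ∀ n ∈ B, (1 : ℝ) / n = (fun x : ℕ × ℕ => (1 : ℝ) / x.1 * (1 / x.2)) (φ n) := by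
    intro n _
    simp only [hφ]
    rw [one_div_mul_one_div, ← Nat.cast_mul, hmul n]
  calc ∑ n ∈ B, (1 : ℝ) / n = ∑ n ∈ B, (fun x : ℕ × ℕ => (1 : ℝ) / x.1 * (1 / x.2)) (φ n) :=
        Finset.sum_congr rfl hval
    _ = ∑ x ∈ B.image φ, (1 : ℝ) / x.1 * (1 / x.2) := by rw [Finset.sum_image hinj]
    _ ≤ ∑ x ∈ Tgt, (1 : ℝ) / x.1 * (1 / x.2) :=
        Finset.sum_le_sum_of_subset_of_nonneg (Finset.image_subset_iff.2 hmaps) fun x _ _ => by positivity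
    _ = (∑ n₁ ∈ R1, (1 : ℝ) / n₁) * ∑ n₂ ∈ Finset.Icc 1 (U / (Zn + 1)), (1 : ℝ) / n₂ := by
        rw [hTgt, Finset.sum_product, Finset.sum_mul_sum]
    _ = _ := mul_comm _ _

end MatomakiRadziwillL3

end Literature.NumberTheory.Sieve

namespace Literature.NumberTheory.Sieve

namespace MatomakiRadziwillL3

open MatomakiRadziwillL13 (sPart sPart_pos sPart_dvd primeFactors_sPart_subset sPart_mem_factoredNumbers
  dvd_sPart_of_dvd sPart_le)

/-! ### The first part: Halász on each fibre, uniformly in `n₁ ≤ X^{3/4}` -/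

/-- The uniform Halász height `Y_* = X^{1/4}/2`. [folklore] -/
def Ystar (X : ℝ) : ℝ := X ^ (1 / 4 : ℝ) / 2

/-- `Σ_S(Y) = ∑_{p ≤ Y, p ∈ S} 1/p`. [folklore] -/
def Sig (S : Finset ℕ) (Y : ℝ) : ℝ := ∑ p ∈ (Nat.primesLE ⌊Y⌋₊).filter (· ∈ S), (1 : ℝ) / p

/-- `Σ_S` is nonnegative and monotone in `Y`. [folklore] -/
theorem Sig_nonneg (S : Finset ℕ) (Y : ℝ) : 0 ≤ Sig S Y :=
  Finset.sum_nonneg fun p _ => by positivity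

/-- `Σ_S` is monotone in `Y`. [folklore] -/
theorem Sig_mono (S : Finset ℕ) {Y Y' : ℝ} (h : Y ≤ Y') : Sig S Y ≤ Sig S Y' := by
  classical
  refine Finset.sum_le_sum_of_subset_of_nonneg (fun p hp => ?_) fun p _ _ => by positivity
  simp only [Finset.mem_filter, Nat.mem_primesLE] at hp ⊢
  exact ⟨⟨hp.1.1.trans (Nat.floor_le_floor h), hp.1.2⟩, hp.2⟩

/-- The uniform lower bound `M₀ = ¼ (log log Y_*/3 − C_D) + ½ Σ_S(Y_*)` for the distances of the sifted
twist on every fibre. [folklore] -/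
def M0 (C_D : ℝ) (S : Finset ℕ) (X : ℝ) : ℝ :=
  (1 / 4) * (Real.log (Real.log (Ystar X)) / 3 - C_D) + (1 / 2) * Sig S (Ystar X)

/-- The endpoints of the fibre over `n₁`: `a = ⌈⌈X⌉/n₁⌉ ≥ X/n₁` and `b = ⌊⌊2X⌋/n₁⌋ ≤ 2X/n₁`. [folklore] -/
theorem fibre_endpoints {X : ℝ} (hX : 1 ≤ X) {n₁ : ℕ} (hn₁ : 1 ≤ n₁) :
    X / n₁ ≤ (((⌈X⌉₊ + n₁ - 1) / n₁ : ℕ) : ℝ) ∧ (((⌊2 * X⌋₊ / n₁ : ℕ) : ℝ)) ≤ 2 * X / n₁ := by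
  have hn0 : (0 : ℝ) < n₁ := by exact_mod_cast hn₁
  constructor
  · rw [div_le_iff₀ hn0]
    have h1 : ⌈X⌉₊ ≤ (⌈X⌉₊ + n₁ - 1) / n₁ * n₁ := by
      have := Nat.lt_div_mul_add (a := ⌈X⌉₊ + n₁ - 1) (by omega : 0 < n₁)
      omega
    calc X ≤ ⌈X⌉₊ := Nat.le_ceil X
      _ ≤ (((⌈X⌉₊ + n₁ - 1) / n₁ * n₁ : ℕ) : ℝ) := by exact_mod_cast h1
      _ = (((⌈X⌉₊ + n₁ - 1) / n₁ : ℕ) : ℝ) * n₁ := by push_cast; ring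
  · calc (((⌊2 * X⌋₊ / n₁ : ℕ) : ℝ)) ≤ (⌊2 * X⌋₊ : ℝ) / n₁ := Nat.cast_div_le
      _ ≤ 2 * X / n₁ := div_le_div_of_nonneg_right (Nat.floor_le (by linarith)) hn0.le

/-- The distance of the sifted twist on a fibre is at least `M₀`: monotonicity in the height down to
`Y_*`, `Msum_siftedTwist_ge`, and MR Lemma 2 (`hD`) at `τ = 2(t + y)`, `|y| ≤ t/2`. [folklore] -/
theorem M0_le_Msum {A' x₀ C_D : ℝ}
    (hD : ∀ x : ℝ, x₀ ≤ x → ∀ τ : ℝ, 2 ≤ |τ| → |τ| ≤ x ^ A' →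
      Real.log (Real.log x) / 3 - C_D ≤ pretentiousDistSq 1 (fun n : ℕ => (n : ℂ) ^ ((τ : ℂ) * I)) x)
    {f : ArithmeticFunction ℝ} (hf1 : ∀ n, |f n| ≤ 1) {S : Finset ℕ} (hS : ∀ p ∈ S, p.Prime)
    {X t A : ℝ} (hX1 : 1 ≤ X) (hYx₀ : x₀ ≤ Ystar X)
    (hXA : 3 * X ^ A ≤ (Ystar X) ^ A') (ht4 : 4 ≤ t) (htA : t ≤ X ^ A) (ht0A : 0 ≤ A)
    {Y : ℝ} (hY : Ystar X ≤ Y) {y : ℝ} (hy : |y| ≤ 2 * (t / 4)) :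
    M0 C_D S X ≤ Msum (siftedTwist f S t) Y y := by
  have h1 := Msum_siftedTwist_ge hf1 hS Y t y
  refine le_trans ?_ h1
  have hmonoD : pretentiousDistSq 1 (fun n : ℕ => (n : ℂ) ^ (((2 * (t + y) : ℝ) : ℂ) * I)) (Ystar X) ≤
      pretentiousDistSq 1 (fun n : ℕ => (n : ℂ) ^ (((2 * (t + y) : ℝ) : ℂ) * I)) Y :=
    pretentiousDistSq_mono (fun n => by simp) (fun n => norm_natCast_cpow_mul_I n _) hY
  have hmonoS : Sig S (Ystar X) ≤ ∑ p ∈ (Nat.primesLE ⌊Y⌋₊).filter (· ∈ S), (1 : ℝ) / p := Sig_mono S hY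
  have hτ1 : 2 ≤ |2 * (t + y)| := by
    rw [abs_mul, abs_two]
    have : t / 2 ≤ |t + y| := by
      have := abs_le.1 hy
      rw [le_abs]; left; linarith
    linarith
  have hτ2 : |2 * (t + y)| ≤ (Ystar X) ^ A' := by
    have : |2 * (t + y)| ≤ 3 * t := by
      rw [abs_le]; have := abs_le.1 hy; constructor <;> linarith
    have hXA' : X ^ A ≥ 1 := Real.one_le_rpow hX1 ht0A
    nlinarith
  have h2 := hD (Ystar X) hYx₀ (2 * (t + y)) hτ1 hτ2
  unfold M0
  linarith

/-- Comparison of the logarithmic factors on a fibre: `log log b / log (a−1) ≤ log log (2X) / log Y_*` for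
`8 ≤ b ≤ 2X`, `4 ≤ Y_* ≤ a − 1`. [folklore] -/
theorem loglog_ratio_le {b aY X Y : ℝ} (hb8 : 8 ≤ b) (hb2X : b ≤ 2 * X) (hY4 : 4 ≤ Y) (hYa : Y ≤ aY) :
    Real.log (Real.log b) / Real.log aY ≤ Real.log (Real.log (2 * X)) / Real.log Y := by
  have hb0 : 0 < b := by linarith
  have he : Real.exp 1 < 4 := by have := Real.exp_one_lt_d9; norm_num at this ⊢; linarith
  have hlogY : 1 < Real.log Y := by
    rw [← Real.log_exp 1]; exact Real.log_lt_log (Real.exp_pos 1) (he.trans_le hY4)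
  have hlogb : 1 < Real.log b := by
    rw [← Real.log_exp 1]; exact Real.log_lt_log (Real.exp_pos 1) (by linarith)
  have hllb : 0 ≤ Real.log (Real.log b) := Real.log_nonneg hlogb.le
  calc Real.log (Real.log b) / Real.log aY
      ≤ Real.log (Real.log (2 * X)) / Real.log aY := by
        refine div_le_div_of_nonneg_right (Real.log_le_log (by linarith) (Real.log_le_log hb0 hb2X)) ?_
        exact Real.log_nonneg (by linarith)
    _ ≤ Real.log (Real.log (2 * X)) / Real.log Y := by
        refine div_le_div_of_nonneg_left ?_ (by linarith) (Real.log_le_log (by linarith) hYa)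
        exact hllb.trans (Real.log_le_log (by linarith) (Real.log_le_log hb0 hb2X))

set_option maxHeartbeats 400000 in
/-- **The Halász bound on one fibre** (uniform in `n₁ ≤ X^{3/4}`): with the constants of `halasz_of_GS`
and of `PretentiousFord.pretentiousDistSq_one_twist_ge` (exponent `A'`), for `X` large
(`Y_* ≥ x₀`, `Y_* ≥ 4`, `3X^A ≤ Y_*^{A'}`), `4 ≤ t ≤ X^A`, real multiplicative `|f| ≤ 1` and `1 ≤ n₁ ≤ X^{3/4}`:
`‖∑_{a ≤ m ≤ b} G(m)/m‖ ≤ 6 (C_H e^{-(39/40) M₀} + C_H (4/t + log log (2X) / log Y_*))`.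
[cite: MatomakiRadziwillAnnals2016, Lemma 3 (proof: "apply Halász's theorem (Lemmas 1 and 2) to the sum over n₂")] -/
theorem fibre_bound {C_H : ℝ} (hC_H : 0 ≤ C_H)
    (hH : ∀ g : ArithmeticFunction ℂ, g.IsMultiplicative → (∀ n, ‖g n‖ ≤ 1) →
      ∀ x T M₀ : ℝ, 3 ≤ x → 1 ≤ T → (∀ y : ℝ, |y| ≤ 2 * T → M₀ ≤ Msum g x y) →
        ‖∑ n ∈ Icc 1 ⌊x⌋₊, g n‖ ≤
          x * (C_H * Real.exp (-(39 / 40) * M₀) + C_H * (1 / T + Real.log (Real.log x) / Real.log x)))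
    {A' x₀ C_D : ℝ}
    (hD : ∀ x : ℝ, x₀ ≤ x → ∀ τ : ℝ, 2 ≤ |τ| → |τ| ≤ x ^ A' →
      Real.log (Real.log x) / 3 - C_D ≤ pretentiousDistSq 1 (fun n : ℕ => (n : ℂ) ^ ((τ : ℂ) * I)) x)
    {f : ArithmeticFunction ℝ} (hf : f.IsMultiplicative) (hf1 : ∀ n, |f n| ≤ 1)
    {P Q X t A : ℝ} (hX1 : 1 ≤ X) (hYx₀ : x₀ ≤ Ystar X) (hY4 : 4 ≤ Ystar X)
    (hXA : 3 * X ^ A ≤ (Ystar X) ^ A') (ht4 : 4 ≤ t) (htA : t ≤ X ^ A) (ht0A : 0 ≤ A)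
    {n₁ : ℕ} (hn₁ : 1 ≤ n₁) (hn₁Z : (n₁ : ℝ) ≤ X ^ (3 / 4 : ℝ)) :
    ‖∑ m ∈ Finset.Icc ((⌈X⌉₊ + n₁ - 1) / n₁) (⌊2 * X⌋₊ / n₁), siftedTwist f (primesPQ P Q) t m / m‖ ≤
      6 * (C_H * Real.exp (-(39 / 40) * M0 C_D (primesPQ P Q) X) +
        C_H * (4 / t + Real.log (Real.log (2 * X)) / Real.log (Ystar X))) := by
  set S := primesPQ P Q with hSdef
  have hS : ∀ p ∈ S, p.Prime := primesPQ_prime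
  set a : ℕ := (⌈X⌉₊ + n₁ - 1) / n₁ with ha
  set b : ℕ := ⌊2 * X⌋₊ / n₁ with hb
  have hX0 : 0 < X := by linarith
  have hn0 : (0 : ℝ) < n₁ := by exact_mod_cast hn₁
  obtain ⟨ha_ge, hb_le⟩ := fibre_endpoints hX1 hn₁
  rw [← ha] at ha_ge; rw [← hb] at hb_le
  -- `a ≥ X/n₁ ≥ X^{1/4} = 2 Y_* ≥ 8`
  have hXn : X ^ (1 / 4 : ℝ) ≤ X / n₁ := by
    rw [le_div_iff₀ hn0]
    calc X ^ (1 / 4 : ℝ) * n₁ ≤ X ^ (1 / 4 : ℝ) * X ^ (3 / 4 : ℝ) :=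
          mul_le_mul_of_nonneg_left hn₁Z (by positivity)
      _ = X := by rw [← Real.rpow_add hX0]; norm_num
  have hYdef : Ystar X = X ^ (1 / 4 : ℝ) / 2 := rfl
  have haY : 2 * Ystar X ≤ a := by rw [hYdef]; linarith
  have ha8 : (8 : ℝ) ≤ a := by linarith
  have ha4 : 4 ≤ a := by exact_mod_cast (show (4 : ℝ) ≤ a by linarith)
  have hb2X : (b : ℝ) ≤ 2 * X := hb_le.trans (by
      rw [div_le_iff₀ hn0]; have : (1:ℝ) ≤ n₁ := by exact_mod_cast hn₁
      nlinarith)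
  have hX8 : (8 : ℝ) ≤ X := by
    have h1 : X / n₁ ≤ X := div_le_self hX0.le (by exact_mod_cast hn₁)
    have h2 : 8 ≤ X ^ (1 / 4 : ℝ) := by rw [hYdef] at hY4; linarith
    linarith
  have hll0 : 0 ≤ Real.log (Real.log (2 * X)) / Real.log (Ystar X) := by
    refine div_nonneg (Real.log_nonneg ?_) (Real.log_nonneg (by linarith))
    have h2X : (16 : ℝ) ≤ 2 * X := by linarith
    rw [← Real.log_exp 1]; refine Real.log_le_log (Real.exp_pos 1) ?_
    have := Real.exp_one_lt_d9; norm_num at this; linarith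
  have hRHS0 : 0 ≤ 6 * (C_H * Real.exp (-(39 / 40) * M0 C_D S X) +
      C_H * (4 / t + Real.log (Real.log (2 * X)) / Real.log (Ystar X))) := by positivity
  -- empty fibre
  rcases lt_or_ge b a with hba | hab
  · rw [Finset.Icc_eq_empty (by omega), Finset.sum_empty, norm_zero]; exact hRHS0
  -- Halász + partial summation on the fibre
  have hT : (1 : ℝ) ≤ t / 4 := by rw [le_div_iff₀ (by norm_num)]; linarith
  have ha1Y : Ystar X ≤ ((a - 1 : ℕ) : ℝ) := by
    have : ((a - 1 : ℕ) : ℝ) = a - 1 := by rw [Nat.cast_sub (by omega)]; simp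
    rw [this]; linarith
  have hM : ∀ y : ℝ, |y| ≤ 2 * (t / 4) → M0 C_D S X ≤ Msum (siftedTwist f S t) ((a - 1 : ℕ) : ℝ) y :=
    fun y hy => M0_le_Msum hD hf1 hS hX1 hYx₀ hXA ht4 htA ht0A ha1Y hy
  have hmain := norm_sum_Icc_div_le hC_H hH (isMultiplicative_siftedTwist hf hS t)
    (norm_siftedTwist_le hf1 S t) ha4 hab hT hM
  refine hmain.trans ?_
  have hb8 : (8 : ℝ) ≤ b := ha8.trans (by exact_mod_cast hab)
  have hba6 : 3 * (b : ℝ) / a ≤ 6 := by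
    rw [div_le_iff₀ (by linarith)]
    have : (b : ℝ) ≤ 2 * (X / n₁) := by rw [← mul_div_assoc]; exact hb_le
    linarith
  have hll := loglog_ratio_le (X := X) hb8 hb2X hY4 ha1Y
  have h4t : 1 / (t / 4) = 4 / t := by field_simp
  rw [h4t]
  have hllb0 : 0 ≤ Real.log (Real.log b) / Real.log ((a - 1 : ℕ) : ℝ) := by
    refine div_nonneg (Real.log_nonneg ?_) (Real.log_nonneg (by linarith))
    rw [← Real.log_exp 1]; refine Real.log_le_log (Real.exp_pos 1) ?_
    have := Real.exp_one_lt_d9; norm_num at this; linarith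
  have hB0 : 0 ≤ C_H * Real.exp (-(39 / 40) * M0 C_D S X) +
      C_H * (4 / t + Real.log (Real.log b) / Real.log ((a - 1 : ℕ) : ℝ)) := by positivity
  have hB : C_H * Real.exp (-(39 / 40) * M0 C_D S X) +
      C_H * (4 / t + Real.log (Real.log b) / Real.log ((a - 1 : ℕ) : ℝ)) ≤
      C_H * Real.exp (-(39 / 40) * M0 C_D S X) +
        C_H * (4 / t + Real.log (Real.log (2 * X)) / Real.log (Ystar X)) := by
    have := mul_le_mul_of_nonneg_left hll hC_H
    linarith
  calc 3 * (b : ℝ) / a * (C_H * Real.exp (-(39 / 40) * M0 C_D S X) +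
        C_H * (4 / t + Real.log (Real.log b) / Real.log ((a - 1 : ℕ) : ℝ)))
      ≤ 6 * (C_H * Real.exp (-(39 / 40) * M0 C_D S X) +
        C_H * (4 / t + Real.log (Real.log b) / Real.log ((a - 1 : ℕ) : ℝ))) :=
        mul_le_mul_of_nonneg_right hba6 hB0
    _ ≤ _ := mul_le_mul_of_nonneg_left hB (by norm_num)

/-- `∑_{p ∈ S} p^{-1}` (real power form, as in `RankinComposed.prod_inv_le_exp`). [folklore] -/
def SigAll (S : Finset ℕ) : ℝ := ∑ p ∈ S, (p : ℝ) ^ (-(1 : ℝ))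

/-- `∑_{n₁ ≤ Z, S-factored} 1/n₁ ≤ exp(∑_{p ∈ S} 1/p + C₀)`. [folklore] -/
theorem sum_inv_factored_le {S : Finset ℕ} (hS : ∀ p ∈ S, p.Prime) (Zn : ℕ) :
    ∑ n₁ ∈ (Finset.Icc 1 Zn).filter (· ∈ Nat.factoredNumbers S), (1 : ℝ) / n₁ ≤
      Real.exp (SigAll S + RankinComposed.C₀) := by
  have h1 := RankinComposed.sum_inv_le_rankin hS (σ := 1) one_pos le_rfl (Z := 1) one_pos
    (R := (Finset.Icc 1 Zn).filter (· ∈ Nat.factoredNumbers S)) (fun n hn => by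
      rw [Finset.mem_filter, Finset.mem_Icc] at hn
      exact ⟨hn.2, by exact_mod_cast hn.1.1⟩)
  rw [Real.one_rpow, one_mul] at h1
  exact h1.trans (RankinComposed.prod_inv_le_exp hS (by norm_num))

/-- **The first part of `R(1+it)`**: for `X` large and `4 ≤ t ≤ X^A`,
`‖∑_{X ≤ n ≤ 2X, s_S(n) ≤ X^{3/4}} F(n)‖ ≤ e^{Σ_S + C₀} · 6 (C_H e^{-(39/40) M₀} + C_H (4/t + log log 2X/log Y_*))`.
[cite: MatomakiRadziwillAnnals2016, Lemma 3 (proof, first term)] -/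
theorem first_part_le {C_H : ℝ} (hC_H : 0 ≤ C_H)
    (hH : ∀ g : ArithmeticFunction ℂ, g.IsMultiplicative → (∀ n, ‖g n‖ ≤ 1) →
      ∀ x T M₀ : ℝ, 3 ≤ x → 1 ≤ T → (∀ y : ℝ, |y| ≤ 2 * T → M₀ ≤ Msum g x y) →
        ‖∑ n ∈ Icc 1 ⌊x⌋₊, g n‖ ≤
          x * (C_H * Real.exp (-(39 / 40) * M₀) + C_H * (1 / T + Real.log (Real.log x) / Real.log x)))
    {A' x₀ C_D : ℝ}
    (hD : ∀ x : ℝ, x₀ ≤ x → ∀ τ : ℝ, 2 ≤ |τ| → |τ| ≤ x ^ A' →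
      Real.log (Real.log x) / 3 - C_D ≤ pretentiousDistSq 1 (fun n : ℕ => (n : ℂ) ^ ((τ : ℂ) * I)) x)
    {f : ArithmeticFunction ℝ} (hf : f.IsMultiplicative) (hf1 : ∀ n, |f n| ≤ 1)
    {P Q X t A : ℝ} (hX1 : 1 ≤ X) (hYx₀ : x₀ ≤ Ystar X) (hY4 : 4 ≤ Ystar X)
    (hXA : 3 * X ^ A ≤ (Ystar X) ^ A') (ht4 : 4 ≤ t) (htA : t ≤ X ^ A) (ht0A : 0 ≤ A) :
    ‖∑ n ∈ (Finset.Icc ⌈X⌉₊ ⌊2 * X⌋₊).filter (fun n => sPart (primesPQ P Q) n ≤ ⌊X ^ (3 / 4 : ℝ)⌋₊),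
        summandR f P Q t n‖ ≤
      Real.exp (SigAll (primesPQ P Q) + RankinComposed.C₀) *
        (6 * (C_H * Real.exp (-(39 / 40) * M0 C_D (primesPQ P Q) X) +
          C_H * (4 / t + Real.log (Real.log (2 * X)) / Real.log (Ystar X)))) := by
  set S := primesPQ P Q with hSdef
  have hS : ∀ p ∈ S, p.Prime := primesPQ_prime
  have hL : 1 ≤ ⌈X⌉₊ := Nat.one_le_iff_ne_zero.2 (Nat.ceil_pos.2 (by linarith)).ne'
  have h1 := norm_sum_small_sPart_le hf hf1 P Q t (L := ⌈X⌉₊) (U := ⌊2 * X⌋₊) (Zn := ⌊X ^ (3 / 4 : ℝ)⌋₊) hL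
  rw [← hSdef] at h1
  refine h1.trans ?_
  set Bnd := 6 * (C_H * Real.exp (-(39 / 40) * M0 C_D S X) +
    C_H * (4 / t + Real.log (Real.log (2 * X)) / Real.log (Ystar X))) with hBnd
  have hfib : ∀ n₁ ∈ (Finset.Icc 1 ⌊X ^ (3 / 4 : ℝ)⌋₊).filter (· ∈ Nat.factoredNumbers S),
      (1 : ℝ) / n₁ * ‖∑ m ∈ Finset.Icc ((⌈X⌉₊ + n₁ - 1) / n₁) (⌊2 * X⌋₊ / n₁), siftedTwist f S t m / m‖ ≤
        (1 : ℝ) / n₁ * Bnd := by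
    intro n₁ hn₁
    rw [Finset.mem_filter, Finset.mem_Icc] at hn₁
    refine mul_le_mul_of_nonneg_left ?_ (by positivity)
    have hn₁Z : (n₁ : ℝ) ≤ X ^ (3 / 4 : ℝ) :=
      (Nat.cast_le.2 hn₁.1.2).trans (Nat.floor_le (by positivity))
    exact fibre_bound hC_H hH hD hf hf1 hX1 hYx₀ hY4 hXA ht4 htA ht0A hn₁.1.1 hn₁Z
  calc ∑ n₁ ∈ (Finset.Icc 1 ⌊X ^ (3 / 4 : ℝ)⌋₊).filter (· ∈ Nat.factoredNumbers S),
        (1 : ℝ) / n₁ * ‖∑ m ∈ Finset.Icc ((⌈X⌉₊ + n₁ - 1) / n₁) (⌊2 * X⌋₊ / n₁), siftedTwist f S t m / m‖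
      ≤ ∑ n₁ ∈ (Finset.Icc 1 ⌊X ^ (3 / 4 : ℝ)⌋₊).filter (· ∈ Nat.factoredNumbers S), (1 : ℝ) / n₁ * Bnd :=
        Finset.sum_le_sum hfib
    _ = (∑ n₁ ∈ (Finset.Icc 1 ⌊X ^ (3 / 4 : ℝ)⌋₊).filter (· ∈ Nat.factoredNumbers S), (1 : ℝ) / n₁) * Bnd := by
        rw [Finset.sum_mul]
    _ ≤ Real.exp (SigAll S + RankinComposed.C₀) * Bnd := by
        refine mul_le_mul_of_nonneg_right (sum_inv_factored_le hS _) ?_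
        -- `Bnd ≥ 0`
        have hY : (1 : ℝ) < Ystar X := by linarith
        have : 0 ≤ Real.log (Real.log (2 * X)) / Real.log (Ystar X) := by
          refine div_nonneg (Real.log_nonneg ?_) (Real.log_nonneg hY.le)
          have hX8 : (8 : ℝ) ≤ X := by
            have hYdef : Ystar X = X ^ (1 / 4 : ℝ) / 2 := rfl
            have h14 : X ^ (1 / 4 : ℝ) ≤ X := by
              calc X ^ (1 / 4 : ℝ) ≤ X ^ (1 : ℝ) := Real.rpow_le_rpow_of_exponent_le hX1 (by norm_num)
                _ = X := Real.rpow_one X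
            rw [hYdef] at hY4; linarith
          rw [← Real.log_exp 1]; refine Real.log_le_log (Real.exp_pos 1) ?_
          have := Real.exp_one_lt_d9; norm_num at this; linarith
        positivity

/-! ### The second part: trivial bound and Rankin's bound -/

/-- `∑_{⌈X⌉ ≤ n ≤ ⌊2X⌋} 1/n ≤ 2` for `X ≥ 1`. [folklore] -/
theorem sum_inv_Icc_le_two {X : ℝ} (hX : 1 ≤ X) :
    ∑ n ∈ Finset.Icc ⌈X⌉₊ ⌊2 * X⌋₊, (1 : ℝ) / n ≤ 2 := by
  have hX0 : 0 < X := by linarith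
  have hL : X ≤ ⌈X⌉₊ := Nat.le_ceil X
  have hpt : ∀ n ∈ Finset.Icc ⌈X⌉₊ ⌊2 * X⌋₊, (1 : ℝ) / n ≤ 1 / X := fun n hn =>
    one_div_le_one_div_of_le hX0 (hL.trans (by exact_mod_cast (Finset.mem_Icc.1 hn).1))
  refine (Finset.sum_le_sum hpt).trans ?_
  rw [Finset.sum_const, nsmul_eq_mul, Nat.card_Icc]
  have hcard : ((⌊2 * X⌋₊ + 1 - ⌈X⌉₊ : ℕ) : ℝ) ≤ X + 1 := by
    have h1 : (⌊2 * X⌋₊ : ℝ) ≤ 2 * X := Nat.floor_le (by linarith)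
    rcases le_or_gt ⌈X⌉₊ (⌊2 * X⌋₊ + 1) with h | h
    · rw [Nat.cast_sub h]; push_cast; linarith
    · rw [Nat.sub_eq_zero_of_le h.le]; push_cast; linarith
  calc ((⌊2 * X⌋₊ + 1 - ⌈X⌉₊ : ℕ) : ℝ) * (1 / X) ≤ (X + 1) * (1 / X) :=
        mul_le_mul_of_nonneg_right hcard (by positivity)
    _ = 1 + 1 / X := by field_simp
    _ ≤ 2 := by have : 1 / X ≤ 1 := by rw [div_le_one hX0]; exact hX
                linarith

/-- **Trivial bound** for any part of `R(1+it)`: `‖∑_{X ≤ n ≤ 2X, n ∈ B} F(n)‖ ≤ 2`. [folklore] -/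
theorem norm_sum_filter_summandR_le_two {f : ArithmeticFunction ℝ} (hf1 : ∀ n, |f n| ≤ 1) (P Q t : ℝ)
    {X : ℝ} (hX : 1 ≤ X) (B : ℕ → Prop) [DecidablePred B] :
    ‖∑ n ∈ (Finset.Icc ⌈X⌉₊ ⌊2 * X⌋₊).filter B, summandR f P Q t n‖ ≤ 2 := by
  have hL : 1 ≤ ⌈X⌉₊ := Nat.one_le_iff_ne_zero.2 (Nat.ceil_pos.2 (by linarith)).ne'
  calc ‖∑ n ∈ (Finset.Icc ⌈X⌉₊ ⌊2 * X⌋₊).filter B, summandR f P Q t n‖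
      ≤ ∑ n ∈ (Finset.Icc ⌈X⌉₊ ⌊2 * X⌋₊).filter B, ‖summandR f P Q t n‖ := norm_sum_le _ _
    _ ≤ ∑ n ∈ (Finset.Icc ⌈X⌉₊ ⌊2 * X⌋₊).filter B, (1 : ℝ) / n := Finset.sum_le_sum fun n hn => by
        have : 1 ≤ n := hL.trans (Finset.mem_Icc.1 (Finset.mem_filter.1 hn).1).1
        exact norm_summandR_le hf1 P Q t this
    _ ≤ ∑ n ∈ Finset.Icc ⌈X⌉₊ ⌊2 * X⌋₊, (1 : ℝ) / n :=
        Finset.sum_le_sum_of_subset_of_nonneg (Finset.filter_subset _ _) fun _ _ _ => by positivity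
    _ ≤ 2 := sum_inv_Icc_le_two hX

/-- The harmonic sum `∑_{n ≤ M} 1/n ≤ 1 + log M` (`M ≥ 1`), from Mathlib's `harmonic_le_one_add_log`. [folklore] -/
theorem sum_inv_le_one_add_log (M : ℕ) :
    ∑ n ∈ Finset.Icc 1 M, (1 : ℝ) / n ≤ 1 + Real.log M := by
  have h := harmonic_le_one_add_log M
  have e : (harmonic M : ℝ) = ∑ n ∈ Finset.Icc 1 M, (1 : ℝ) / n := by
    rw [harmonic_eq_sum_Icc, Rat.cast_sum]
    refine Finset.sum_congr rfl fun n _ => ?_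
    push_cast; rw [one_div]
  linarith [e ▸ h]

/-- **Rankin's bound for the second part**: for `0 < η ≤ 2/5` and `X ≥ 1`,
`‖∑_{X ≤ n ≤ 2X, s_S(n) > X^{3/4}} F(n)‖ ≤ (1 + log (2X)) X^{-3η/4} exp(∑_{p ∈ S} p^{-(1-η)} + C₀)`.
[cite: MatomakiRadziwillAnnals2016, Lemma 3 (proof: "by an estimate for the number of Q-smooth numbers")] -/
theorem second_part_rankin {f : ArithmeticFunction ℝ} (hf1 : ∀ n, |f n| ≤ 1) (P Q t : ℝ) {X : ℝ} (hX : 1 ≤ X)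
    {η : ℝ} (hη0 : 0 < η) (hη : η ≤ 2 / 5) :
    ‖∑ n ∈ (Finset.Icc ⌈X⌉₊ ⌊2 * X⌋₊).filter (fun n => ⌊X ^ (3 / 4 : ℝ)⌋₊ < sPart (primesPQ P Q) n),
        summandR f P Q t n‖ ≤
      (1 + Real.log (2 * X)) * (X ^ (-(3 * η / 4))) *
        Real.exp (∑ p ∈ primesPQ P Q, (p : ℝ) ^ (-(1 - η)) + RankinComposed.C₀) := by
  set S := primesPQ P Q with hSdef
  have hS : ∀ p ∈ S, p.Prime := primesPQ_prime
  have hX0 : 0 < X := by linarith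
  have hL : 1 ≤ ⌈X⌉₊ := Nat.one_le_iff_ne_zero.2 (Nat.ceil_pos.2 hX0).ne'
  set Zn := ⌊X ^ (3 / 4 : ℝ)⌋₊ with hZn
  have h1 := norm_sum_large_sPart_le hf1 P Q t (L := ⌈X⌉₊) (U := ⌊2 * X⌋₊) (Zn := Zn) hL
  rw [← hSdef] at h1
  refine h1.trans ?_
  -- the harmonic factor
  have hM : ∑ n₂ ∈ Finset.Icc 1 (⌊2 * X⌋₊ / (Zn + 1)), (1 : ℝ) / n₂ ≤ 1 + Real.log (2 * X) := by
    rcases Nat.eq_zero_or_pos (⌊2 * X⌋₊ / (Zn + 1)) with h0 | hpos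
    · rw [h0]; simp
      have : 0 ≤ Real.log (2 * X) := Real.log_nonneg (by linarith)
      linarith
    · refine (sum_inv_le_one_add_log _).trans ?_
      have : ((⌊2 * X⌋₊ / (Zn + 1) : ℕ) : ℝ) ≤ 2 * X :=
        (Nat.cast_le.2 (Nat.div_le_self _ _)).trans (Nat.floor_le (by linarith))
      have h0' : (0 : ℝ) < ((⌊2 * X⌋₊ / (Zn + 1) : ℕ) : ℝ) := by exact_mod_cast hpos
      linarith [Real.log_le_log h0' this]
  -- Rankin on the `n₁`-sum
  have hZ : (0 : ℝ) < (Zn : ℝ) + 1 := by positivity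
  have hR := RankinComposed.sum_inv_le_rankin hS (σ := 1 - η) (by linarith) (by linarith) hZ
    (R := (Finset.Icc (Zn + 1) ⌊2 * X⌋₊).filter (· ∈ Nat.factoredNumbers S)) (fun n hn => by
      rw [Finset.mem_filter, Finset.mem_Icc] at hn
      exact ⟨hn.2, by exact_mod_cast hn.1.1⟩)
  have hprod := RankinComposed.prod_inv_le_exp hS (σ := 1 - η) (by linarith)
  have hZpow : ((Zn : ℝ) + 1) ^ (-(1 - (1 - η))) ≤ X ^ (-(3 * η / 4)) := by
    have e1 : -(1 - (1 - η)) = -η := by ring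
    rw [e1]
    have hZX : X ^ (3 / 4 : ℝ) ≤ (Zn : ℝ) + 1 := (Nat.lt_floor_add_one _).le
    calc ((Zn : ℝ) + 1) ^ (-η) ≤ (X ^ (3 / 4 : ℝ)) ^ (-η) :=
          Real.rpow_le_rpow_of_nonpos (by positivity) hZX (by linarith)
      _ = X ^ (-(3 * η / 4)) := by rw [← Real.rpow_mul hX0.le]; ring_nf
  have hsum0 : 0 ≤ ∑ n₁ ∈ (Finset.Icc (Zn + 1) ⌊2 * X⌋₊).filter (· ∈ Nat.factoredNumbers S), (1 : ℝ) / n₁ :=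
    Finset.sum_nonneg fun _ _ => by positivity
  have hH0 : 0 ≤ ∑ n₂ ∈ Finset.Icc 1 (⌊2 * X⌋₊ / (Zn + 1)), (1 : ℝ) / n₂ :=
    Finset.sum_nonneg fun _ _ => by positivity
  calc (∑ n₂ ∈ Finset.Icc 1 (⌊2 * X⌋₊ / (Zn + 1)), (1 : ℝ) / n₂) *
        ∑ n₁ ∈ (Finset.Icc (Zn + 1) ⌊2 * X⌋₊).filter (· ∈ Nat.factoredNumbers S), (1 : ℝ) / n₁
      ≤ (1 + Real.log (2 * X)) *
          ((((Zn : ℝ) + 1) ^ (-(1 - (1 - η)))) * ∏ p ∈ S, (1 - (p : ℝ) ^ (-(1 - η)))⁻¹) :=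
        mul_le_mul hM hR hsum0 (by linarith [hH0.trans hM])
    _ ≤ (1 + Real.log (2 * X)) * (X ^ (-(3 * η / 4)) *
          Real.exp (∑ p ∈ S, (p : ℝ) ^ (-(1 - η)) + RankinComposed.C₀)) := by
        refine mul_le_mul_of_nonneg_left ?_ (by linarith [hH0.trans hM])
        refine mul_le_mul hZpow hprod ?_ (by positivity)
        exact Finset.prod_nonneg fun p hp => inv_nonneg.2 (by
          have : (p : ℝ) ^ (-(1 - η)) ≤ 1 := Real.rpow_le_one_of_one_le_of_nonpos
            (by exact_mod_cast (hS p hp).one_lt.le) (by linarith)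
          linarith)
    _ = _ := by ring

/-- The prime sum in Rankin's bound: `∑_{p ∈ S} p^{-(1-η)} ≤ ∑_{p ∈ S} p^{-1} + 3 + 24 Q^η`
(`S = 𝒫 ∩ [P, Q]`, `2 ≤ Q`, `0 < η ≤ 1/2`; `RankinComposed.sum_excess_le`). [folklore] -/
theorem sum_rpow_primesPQ_le {P Q : ℝ} (hQ : 2 ≤ Q) {η : ℝ} (hη0 : 0 < η) (hη : η ≤ 1 / 2) :
    ∑ p ∈ primesPQ P Q, (p : ℝ) ^ (-(1 - η)) ≤ SigAll (primesPQ P Q) + 3 + 24 * Q ^ η := by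
  classical
  have hQ2 : 2 ≤ ⌊Q⌋₊ := Nat.le_floor (by simpa using hQ)
  -- termwise `p^{-(1-η)} = p^{-1} + (p^η - 1)/p`
  have hpt : ∀ p ∈ primesPQ P Q, (p : ℝ) ^ (-(1 - η)) = (p : ℝ) ^ (-(1 : ℝ)) + ((p : ℝ) ^ η - 1) / p := by
    intro p hp
    have hp0 : (0 : ℝ) < p := by exact_mod_cast (primesPQ_prime p hp).pos
    rw [Real.rpow_neg_one, show -(1 - η) = η + (-1) by ring, Real.rpow_add hp0, Real.rpow_neg_one]
    field_simp; ring
  rw [Finset.sum_congr rfl hpt, Finset.sum_add_distrib, SigAll, add_assoc]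
  gcongr ?_ + ?_
  · exact le_rfl
  -- compare with the sum over all primes `≤ ⌊Q⌋`
  have hsub : primesPQ P Q ⊆ Nat.primesLE ⌊Q⌋₊ := by
    intro p hp
    rw [primesPQ, Finset.mem_filter, Finset.mem_Icc] at hp
    exact Nat.mem_primesLE.2 ⟨hp.1.2, hp.2⟩
  have hnn : ∀ p ∈ Nat.primesLE ⌊Q⌋₊, 0 ≤ ((p : ℝ) ^ η - 1) / p := fun p hp => by
    have hp1 : (1 : ℝ) ≤ p := by exact_mod_cast (Nat.mem_primesLE.1 hp).2.one_lt.le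
    exact div_nonneg (by linarith [Real.one_le_rpow hp1 hη0.le]) (by linarith)
  calc ∑ p ∈ primesPQ P Q, ((p : ℝ) ^ η - 1) / p ≤ ∑ p ∈ Nat.primesLE ⌊Q⌋₊, ((p : ℝ) ^ η - 1) / p :=
        Finset.sum_le_sum_of_subset_of_nonneg hsub fun p hp _ => hnn p hp
    _ ≤ 3 + 24 * (⌊Q⌋₊ : ℝ) ^ η := RankinComposed.sum_excess_le hQ2 hη0 hη
    _ ≤ 3 + 24 * Q ^ η := by
        have : (⌊Q⌋₊ : ℝ) ^ η ≤ Q ^ η := Real.rpow_le_rpow (Nat.cast_nonneg _) (Nat.floor_le (by linarith)) hη0.le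
        linarith

/-! ### Mertens estimates for `S = 𝒫 ∩ [P, Q]` -/

/-- `∑_{p ∈ S} 1/p` over `S = 𝒫 ∩ [P,Q]` as an interval prime sum. [folklore] -/
theorem SigAll_eq (P Q : ℝ) :
    SigAll (primesPQ P Q) = ∑ p ∈ (Finset.Icc ⌈P⌉₊ ⌊Q⌋₊).filter Nat.Prime, (1 : ℝ) / p := by
  unfold SigAll primesPQ
  refine Finset.sum_congr rfl fun p _ => ?_
  rw [Real.rpow_neg_one, one_div]

/-- **Upper Mertens for `S`**: `∑_{p ∈ S} 1/p ≤ log log Q − log log P + C_M` (`2 ≤ P ≤ Q`), with the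
constant of `RankinComposed.exists_abs_sum_inv_primes_Icc_sub_le`. [folklore] -/
theorem SigAll_le {C_M : ℝ}
    (hCM : ∀ P Q : ℕ, 2 ≤ P → P ≤ Q → |∑ p ∈ (Finset.Icc P Q).filter Nat.Prime, (1 : ℝ) / p
        - (Real.log (Real.log Q) - Real.log (Real.log P))| ≤ C_M)
    {P Q : ℝ} (hP : 2 ≤ P) (hPQ : P ≤ Q) :
    SigAll (primesPQ P Q) ≤ Real.log (Real.log Q) - Real.log (Real.log P) + C_M := by
  have hCM0 : 0 ≤ C_M := le_trans (abs_nonneg _) (hCM 2 2 le_rfl le_rfl)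
  have hP' : 2 ≤ ⌈P⌉₊ := by
    have : (1 : ℕ) < ⌈P⌉₊ := Nat.lt_ceil.2 (by push_cast; linarith)
    omega
  have hlogP : 0 < Real.log P := Real.log_pos (by linarith)
  have hlogQ : 0 < Real.log Q := Real.log_pos (by linarith)
  have hll : Real.log (Real.log P) ≤ Real.log (Real.log Q) := Real.log_le_log hlogP (Real.log_le_log (by linarith) hPQ)
  rw [SigAll_eq]
  rcases le_or_gt ⌈P⌉₊ ⌊Q⌋₊ with h | h
  · have := (abs_le.1 (hCM ⌈P⌉₊ ⌊Q⌋₊ hP' h)).2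
    have h1 : Real.log (Real.log (⌊Q⌋₊ : ℝ)) ≤ Real.log (Real.log Q) := by
      have hQ' : (2 : ℝ) ≤ (⌊Q⌋₊ : ℝ) := by exact_mod_cast hP'.trans h
      exact Real.log_le_log (Real.log_pos (by linarith)) (Real.log_le_log (by linarith) (Nat.floor_le (by linarith)))
    have h2 : Real.log (Real.log P) ≤ Real.log (Real.log (⌈P⌉₊ : ℝ)) :=
      Real.log_le_log hlogP (Real.log_le_log (by linarith) (Nat.le_ceil P))
    linarith
  · rw [Finset.Icc_eq_empty (by omega), Finset.filter_empty, Finset.sum_empty]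
    linarith

/-- `exp(∑_{p ∈ S} 1/p) ≤ e^{C_M} log Q / log P`. [folklore] -/
theorem exp_SigAll_le {C_M : ℝ}
    (hCM : ∀ P Q : ℕ, 2 ≤ P → P ≤ Q → |∑ p ∈ (Finset.Icc P Q).filter Nat.Prime, (1 : ℝ) / p
        - (Real.log (Real.log Q) - Real.log (Real.log P))| ≤ C_M)
    {P Q : ℝ} (hP : 2 ≤ P) (hPQ : P ≤ Q) :
    Real.exp (SigAll (primesPQ P Q)) ≤ Real.exp C_M * (Real.log Q / Real.log P) := by
  have h := SigAll_le hCM hP hPQ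
  have hlogP : 0 < Real.log P := Real.log_pos (by linarith)
  have hlogQ : 0 < Real.log Q := Real.log_pos (by linarith)
  calc Real.exp (SigAll (primesPQ P Q)) ≤ Real.exp (Real.log (Real.log Q) - Real.log (Real.log P) + C_M) :=
        Real.exp_le_exp.2 h
    _ = Real.exp C_M * (Real.log Q / Real.log P) := by
        rw [Real.exp_add, Real.exp_sub, Real.exp_log hlogQ, Real.exp_log hlogP]; ring

/-- **The tail beyond `Y`**: `∑_{p ∈ S} 1/p − Σ_S(Y) ≤ log log Q − log log Y + C_M` for `2 ≤ Y ≤ Q`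
(the primes of `S` above `Y` lie in `(⌊Y⌋, ⌊Q⌋]`). [folklore] -/
theorem SigAll_sub_Sig_le {C_M : ℝ}
    (hCM : ∀ P Q : ℕ, 2 ≤ P → P ≤ Q → |∑ p ∈ (Finset.Icc P Q).filter Nat.Prime, (1 : ℝ) / p
        - (Real.log (Real.log Q) - Real.log (Real.log P))| ≤ C_M)
    {P Q Y : ℝ} (hY : 2 ≤ Y) (hYQ : Y ≤ Q) :
    SigAll (primesPQ P Q) - Sig (primesPQ P Q) Y ≤ Real.log (Real.log Q) - Real.log (Real.log Y) + C_M := by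
  classical
  have hCM0 : 0 ≤ C_M := le_trans (abs_nonneg _) (hCM 2 2 le_rfl le_rfl)
  set S := primesPQ P Q with hSdef
  -- `SigAll S = ∑_{p ∈ S, p ≤ ⌊Y⌋} + ∑_{p ∈ S, p > ⌊Y⌋}` and `Sig S Y = ∑_{p ∈ S, p ≤ ⌊Y⌋}`
  have hSig : Sig S Y = ∑ p ∈ S.filter (fun p => p ≤ ⌊Y⌋₊), (1 : ℝ) / p := by
    unfold Sig
    refine Finset.sum_congr ?_ fun _ _ => rfl
    ext p
    simp only [Finset.mem_filter, Nat.mem_primesLE, hSdef, primesPQ, Finset.mem_Icc]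
    tauto
  have hsplit : SigAll S = ∑ p ∈ S.filter (fun p => p ≤ ⌊Y⌋₊), (1 : ℝ) / p +
      ∑ p ∈ S.filter (fun p => ¬ p ≤ ⌊Y⌋₊), (1 : ℝ) / p := by
    rw [Finset.sum_filter_add_sum_filter_not S (fun p => p ≤ ⌊Y⌋₊)]
    unfold SigAll
    refine Finset.sum_congr rfl fun p _ => ?_
    rw [Real.rpow_neg_one, one_div]
  rw [hSig, hsplit, add_sub_cancel_left]
  -- the tail is a prime sum over `[⌊Y⌋+1, ⌊Q⌋]`
  have hY2 : 2 ≤ ⌊Y⌋₊ := Nat.le_floor (by simpa using hY)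
  have hsub : S.filter (fun p => ¬ p ≤ ⌊Y⌋₊) ⊆ (Finset.Icc (⌊Y⌋₊ + 1) ⌊Q⌋₊).filter Nat.Prime := by
    intro p hp
    simp only [Finset.mem_filter, hSdef, primesPQ, Finset.mem_Icc] at hp ⊢
    exact ⟨⟨by omega, hp.1.1.2⟩, hp.1.2⟩
  have htail : ∑ p ∈ S.filter (fun p => ¬ p ≤ ⌊Y⌋₊), (1 : ℝ) / p ≤
      ∑ p ∈ (Finset.Icc (⌊Y⌋₊ + 1) ⌊Q⌋₊).filter Nat.Prime, (1 : ℝ) / p :=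
    Finset.sum_le_sum_of_subset_of_nonneg hsub fun _ _ _ => by positivity
  refine htail.trans ?_
  have hlogY : 0 < Real.log Y := Real.log_pos (by linarith)
  have hllY : Real.log (Real.log Y) ≤ Real.log (Real.log ((⌊Y⌋₊ + 1 : ℕ) : ℝ)) :=
    Real.log_le_log hlogY (Real.log_le_log (by linarith) (by exact_mod_cast (Nat.lt_floor_add_one Y).le))
  have hllQ' : ∀ hq : (2:ℝ) ≤ ⌊Q⌋₊, Real.log (Real.log (⌊Q⌋₊ : ℝ)) ≤ Real.log (Real.log Q) := fun hq =>
    Real.log_le_log (Real.log_pos (by linarith)) (Real.log_le_log (by linarith) (Nat.floor_le (by linarith)))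
  rcases le_or_gt (⌊Y⌋₊ + 1) ⌊Q⌋₊ with h | h
  · have := (abs_le.1 (hCM (⌊Y⌋₊ + 1) ⌊Q⌋₊ (by omega) h)).2
    have hq : (2:ℝ) ≤ ⌊Q⌋₊ := by exact_mod_cast (show 2 ≤ ⌊Q⌋₊ by omega)
    linarith [hllQ' hq]
  · rw [Finset.Icc_eq_empty (by omega), Finset.filter_empty, Finset.sum_empty]
    have : Real.log (Real.log Y) ≤ Real.log (Real.log Q) := Real.log_le_log hlogY (Real.log_le_log (by linarith) hYQ)
    linarith

/-- The tail bound without the hypothesis `Y ≤ Q`: `∑_{p ∈ S} 1/p − Σ_S(Y) ≤ log log (max Q Y) − log log Y + C_M`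
for `2 ≤ Y`. [folklore] -/
theorem SigAll_sub_Sig_le' {C_M : ℝ}
    (hCM : ∀ P Q : ℕ, 2 ≤ P → P ≤ Q → |∑ p ∈ (Finset.Icc P Q).filter Nat.Prime, (1 : ℝ) / p
        - (Real.log (Real.log Q) - Real.log (Real.log P))| ≤ C_M)
    {P Q Y : ℝ} (hY : 2 ≤ Y) :
    SigAll (primesPQ P Q) - Sig (primesPQ P Q) Y ≤
      Real.log (Real.log (max Q Y)) - Real.log (Real.log Y) + C_M := by
  classical
  have hCM0 : 0 ≤ C_M := le_trans (abs_nonneg _) (hCM 2 2 le_rfl le_rfl)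
  rcases le_or_gt Y Q with h | h
  · rw [max_eq_left h]; exact SigAll_sub_Sig_le hCM hY h
  · rw [max_eq_right h.le]
    -- all of `S` lies below `Y`: `Sig S Y = SigAll S`
    have hle : SigAll (primesPQ P Q) ≤ Sig (primesPQ P Q) Y := by
      unfold SigAll Sig
      have e : ∀ p ∈ primesPQ P Q, (p : ℝ) ^ (-(1 : ℝ)) = 1 / p := fun p _ => by rw [Real.rpow_neg_one, one_div]
      rw [Finset.sum_congr rfl e]
      refine Finset.sum_le_sum_of_subset_of_nonneg (fun p hp => ?_) fun _ _ _ => by positivity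
      have hp' := hp
      rw [primesPQ, Finset.mem_filter, Finset.mem_Icc] at hp'
      simp only [Finset.mem_filter, Nat.mem_primesLE]
      exact ⟨⟨hp'.1.2.trans (Nat.floor_le_floor h.le), hp'.2⟩, hp⟩
    linarith

/-- `log log (2X) ≤ 3 (log X)^{1/2}` for `log X ≥ 1`. [folklore] -/
theorem loglog_two_mul_le {X : ℝ} (hX1 : 1 ≤ X) (hX : 1 ≤ Real.log X) :
    Real.log (Real.log (2 * X)) ≤ 3 * Real.log X ^ (1 / 2 : ℝ) := by
  have hX0 : 0 < X := by linarith
  have hlog2 : Real.log 2 < 1 := by have := Real.log_two_lt_d9; linarith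
  have h2X : Real.log (2 * X) ≤ 2 * Real.log X := by
    rw [Real.log_mul (by norm_num) hX0.ne']; linarith
  have hpos : 0 < Real.log (2 * X) := by rw [Real.log_mul (by norm_num) hX0.ne']; linarith [Real.log_pos one_lt_two]
  have h1 : Real.log (Real.log (2 * X)) ≤ Real.log (2 * Real.log X) := Real.log_le_log hpos h2X
  have h2 : Real.log (2 * Real.log X) ≤ (2 * Real.log X) ^ (1 / 2 : ℝ) / (1 / 2) :=
    Real.log_le_rpow_div (by linarith) (by norm_num)
  have h3 : (2 * Real.log X) ^ (1 / 2 : ℝ) = (2 : ℝ) ^ (1 / 2 : ℝ) * Real.log X ^ (1 / 2 : ℝ) :=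
    Real.mul_rpow (by norm_num) (by linarith)
  have h4 : (2 : ℝ) ^ (1 / 2 : ℝ) ≤ 3 / 2 := by
    have : ((2 : ℝ) ^ (1 / 2 : ℝ)) ^ (2 : ℕ) = 2 := by
      rw [← Real.rpow_natCast, ← Real.rpow_mul (by norm_num)]; norm_num
    nlinarith [Real.rpow_nonneg (by norm_num : (0:ℝ) ≤ 2) (1 / 2 : ℝ)]
  have h5 : 0 ≤ Real.log X ^ (1 / 2 : ℝ) := by positivity
  calc Real.log (Real.log (2 * X)) ≤ (2 * Real.log X) ^ (1 / 2 : ℝ) / (1 / 2) := h1.trans h2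
    _ = 2 * ((2 : ℝ) ^ (1 / 2 : ℝ) * Real.log X ^ (1 / 2 : ℝ)) := by rw [h3]; ring
    _ ≤ 3 * Real.log X ^ (1 / 2 : ℝ) := by nlinarith

/-! ### The three terms of the first part, as functions of `ℓ = log X`, `r = log Q / log P` -/

/-- `exp((41/80) s) ≤ e^{C_M} r` from `exp s ≤ e^{C_M} r ≥ 1`. [folklore] -/
theorem exp_frac_le {s C_M r : ℝ} (hCM : 0 ≤ C_M) (hr : 1 ≤ r) (hs : Real.exp s ≤ Real.exp C_M * r) :
    Real.exp ((41 / 80) * s) ≤ Real.exp C_M * r := by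
  have h1 : (1 : ℝ) ≤ Real.exp C_M * r := by
    have := Real.one_le_exp hCM; nlinarith
  rcases le_or_gt s 0 with h | h
  · calc Real.exp ((41 / 80) * s) ≤ Real.exp 0 := Real.exp_le_exp.2 (by nlinarith)
      _ = 1 := Real.exp_zero
      _ ≤ _ := h1
  · exact (Real.exp_le_exp.2 (by nlinarith)).trans hs

/-- **Term A** (the Halász saving): with `y = log Y_* ≥ ℓ/5`,
`e^{s + C₀} · 6 C_H e^{-(39/40) M₀} ≤ 30 C_H e^{C₀ + 2C_M + (39/80)(log 5 + C_M) + (39/160)|C_D|} · r · e^{-(log ℓ)/16}`. [folklore] -/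
theorem termA_le {C_H C_D C_M C0 s sst y ℓ r : ℝ} (hC_H : 0 ≤ C_H) (hCM : 0 ≤ C_M) (hℓ : 1 ≤ ℓ)
    (hy : ℓ / 5 ≤ y) (hr : 1 ≤ r) (hs : Real.exp s ≤ Real.exp C_M * r) (htail : s - sst ≤ Real.log 5 + C_M) :
    Real.exp (s + C0) * (6 * (C_H * Real.exp (-(39 / 40) * ((1 / 4) * (Real.log y / 3 - C_D) + (1 / 2) * sst)))) ≤
      30 * C_H * Real.exp (C0 + 2 * C_M + (39 / 80) * (Real.log 5 + C_M) + (39 / 160) * |C_D|) * r *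
        Real.exp (-(Real.log ℓ / 16)) := by
  have hy0 : 0 < y := by linarith
  have hℓ0 : 0 < ℓ := by linarith
  have hlogℓ : 0 ≤ Real.log ℓ := Real.log_nonneg hℓ
  have hlog5 : 0 ≤ Real.log 5 := Real.log_nonneg (by norm_num)
  have hlogy : Real.log ℓ - Real.log 5 ≤ Real.log y := by
    rw [← Real.log_div hℓ0.ne' (by norm_num)]; exact Real.log_le_log (by positivity) hy
  -- combine the exponentials
  have hCD : C_D ≤ |C_D| := le_abs_self _
  have hE' : s + C0 + -(39 / 40) * ((1 / 4) * (Real.log y / 3 - C_D) + (1 / 2) * sst) ≤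
      (41 / 80) * s + (C0 + C_M + (39 / 80) * (Real.log 5 + C_M) + (39 / 160) * |C_D|) +
        (Real.log 5 + -(Real.log ℓ / 16)) := by
    linarith
  have hE : Real.exp (s + C0) * Real.exp (-(39 / 40) * ((1 / 4) * (Real.log y / 3 - C_D) + (1 / 2) * sst)) ≤
      Real.exp ((41 / 80) * s) * Real.exp (C0 + C_M + (39 / 80) * (Real.log 5 + C_M) + (39 / 160) * |C_D|) *
        (5 * Real.exp (-(Real.log ℓ / 16))) := by
    calc Real.exp (s + C0) * Real.exp (-(39 / 40) * ((1 / 4) * (Real.log y / 3 - C_D) + (1 / 2) * sst))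
        = Real.exp (s + C0 + -(39 / 40) * ((1 / 4) * (Real.log y / 3 - C_D) + (1 / 2) * sst)) := by rw [← Real.exp_add]
      _ ≤ Real.exp ((41 / 80) * s + (C0 + C_M + (39 / 80) * (Real.log 5 + C_M) + (39 / 160) * |C_D|) +
          (Real.log 5 + -(Real.log ℓ / 16))) := Real.exp_le_exp.2 hE'
      _ = _ := by
          have e5 : Real.exp (Real.log 5 + -(Real.log ℓ / 16)) = 5 * Real.exp (-(Real.log ℓ / 16)) := by
            rw [Real.exp_add, Real.exp_log (by norm_num)]
          rw [← e5, ← Real.exp_add, ← Real.exp_add]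
  have h5 : Real.exp ((41 / 80) * s) ≤ Real.exp C_M * r := exp_frac_le hCM hr hs
  have hK0 : 0 ≤ Real.exp (C0 + C_M + (39 / 80) * (Real.log 5 + C_M) + (39 / 160) * |C_D|) *
      (5 * Real.exp (-(Real.log ℓ / 16))) := by positivity
  calc Real.exp (s + C0) * (6 * (C_H * Real.exp (-(39 / 40) * ((1 / 4) * (Real.log y / 3 - C_D) + (1 / 2) * sst))))
      = 6 * C_H * (Real.exp (s + C0) * Real.exp (-(39 / 40) * ((1 / 4) * (Real.log y / 3 - C_D) + (1 / 2) * sst))) := by ring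
    _ ≤ 6 * C_H * (Real.exp ((41 / 80) * s) * Real.exp (C0 + C_M + (39 / 80) * (Real.log 5 + C_M) + (39 / 160) * |C_D|) *
        (5 * Real.exp (-(Real.log ℓ / 16)))) := mul_le_mul_of_nonneg_left hE (by positivity)
    _ ≤ 6 * C_H * ((Real.exp C_M * r) * Real.exp (C0 + C_M + (39 / 80) * (Real.log 5 + C_M) + (39 / 160) * |C_D|) *
        (5 * Real.exp (-(Real.log ℓ / 16)))) := by
        refine mul_le_mul_of_nonneg_left ?_ (by positivity)
        rw [mul_assoc, mul_assoc]
        exact mul_le_mul_of_nonneg_right h5 hK0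
    _ = 30 * C_H * (Real.exp C_M * Real.exp (C0 + C_M + (39 / 80) * (Real.log 5 + C_M) + (39 / 160) * |C_D|)) * r *
        Real.exp (-(Real.log ℓ / 16)) := by ring
    _ = _ := by rw [← Real.exp_add]; ring_nf

/-- **Term B** (`1/T`): `e^{s + C₀} · 6 C_H · 4/t ≤ 24 C_H e^{C₀ + C_M} r e^{-(log ℓ)/16}` for `t ≥ e^{(log ℓ)/16}`.
[folklore] -/
theorem termB_le {C_H C_M C0 s ℓ r t : ℝ} (hC_H : 0 ≤ C_H) (hr : 1 ≤ r)
    (hs : Real.exp s ≤ Real.exp C_M * r) (ht : Real.exp (Real.log ℓ / 16) ≤ t) :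
    Real.exp (s + C0) * (6 * (C_H * (4 / t))) ≤ 24 * C_H * Real.exp (C0 + C_M) * r * Real.exp (-(Real.log ℓ / 16)) := by
  have ht0 : 0 < t := lt_of_lt_of_le (Real.exp_pos _) ht
  have h4 : 4 / t ≤ 4 * Real.exp (-(Real.log ℓ / 16)) := by
    rw [Real.exp_neg, div_eq_mul_inv]
    exact mul_le_mul_of_nonneg_left (inv_anti₀ (Real.exp_pos _) ht) (by norm_num)
  have hs' : Real.exp (s + C0) ≤ Real.exp C_M * r * Real.exp C0 := by
    rw [Real.exp_add]; exact mul_le_mul_of_nonneg_right hs (Real.exp_pos _).le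
  calc Real.exp (s + C0) * (6 * (C_H * (4 / t)))
      ≤ (Real.exp C_M * r * Real.exp C0) * (6 * (C_H * (4 * Real.exp (-(Real.log ℓ / 16))))) :=
        mul_le_mul hs' (by gcongr) (by positivity) (by positivity)
    _ = 24 * C_H * (Real.exp C0 * Real.exp C_M) * r * Real.exp (-(Real.log ℓ / 16)) := by ring
    _ = _ := by rw [← Real.exp_add]

/-- **Term C** (`log log x / log x`): with `L = log log (2X) ≤ 3 e^{(log ℓ)/2}` and `y ≥ ℓ/5`,
`e^{s + C₀} · 6 C_H · L / y ≤ 90 C_H e^{C₀ + C_M} r e^{-(log ℓ)/16}`. [folklore] -/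
theorem termC_le {C_H C_M C0 s ℓ r y L : ℝ} (hC_H : 0 ≤ C_H) (hℓ : 1 ≤ ℓ) (hy : ℓ / 5 ≤ y)
    (hr : 1 ≤ r) (hs : Real.exp s ≤ Real.exp C_M * r) (hL0 : 0 ≤ L) (hL : L ≤ 3 * Real.exp (Real.log ℓ / 2)) :
    Real.exp (s + C0) * (6 * (C_H * (L / y))) ≤ 90 * C_H * Real.exp (C0 + C_M) * r * Real.exp (-(Real.log ℓ / 16)) := by
  have hℓ0 : 0 < ℓ := by linarith
  have hy0 : 0 < y := by linarith
  have hlogℓ : 0 ≤ Real.log ℓ := Real.log_nonneg hℓ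
  -- `L / y ≤ 15 e^{(log ℓ)/2} / ℓ = 15 e^{-(log ℓ)/2} ≤ 15 e^{-(log ℓ)/16}`
  have hLy : L / y ≤ 15 * Real.exp (-(Real.log ℓ / 16)) := by
    rw [div_le_iff₀ hy0]
    have h1 : Real.exp (Real.log ℓ / 2) * 5 ≤ 5 * Real.exp (-(Real.log ℓ / 16)) * ℓ := by
      have e : Real.exp (-(Real.log ℓ / 16)) * ℓ = Real.exp ((15 / 16) * Real.log ℓ) := by
        rw [show (15 / 16 : ℝ) * Real.log ℓ = -(Real.log ℓ / 16) + Real.log ℓ by ring, Real.exp_add,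
          Real.exp_log hℓ0]
      rw [mul_assoc, e]
      have : Real.exp (Real.log ℓ / 2) ≤ Real.exp ((15 / 16) * Real.log ℓ) := Real.exp_le_exp.2 (by nlinarith)
      linarith
    nlinarith [Real.exp_pos (Real.log ℓ / 2), Real.exp_pos (-(Real.log ℓ / 16))]
  have hs' : Real.exp (s + C0) ≤ Real.exp C_M * r * Real.exp C0 := by
    rw [Real.exp_add]; exact mul_le_mul_of_nonneg_right hs (Real.exp_pos _).le
  calc Real.exp (s + C0) * (6 * (C_H * (L / y)))
      ≤ (Real.exp C_M * r * Real.exp C0) * (6 * (C_H * (15 * Real.exp (-(Real.log ℓ / 16))))) :=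
        mul_le_mul hs' (by gcongr) (by positivity) (by positivity)
    _ = 90 * C_H * (Real.exp C0 * Real.exp C_M) * r * Real.exp (-(Real.log ℓ / 16)) := by ring
    _ = _ := by rw [← Real.exp_add]

/-- `r e^{-(log ℓ)/16} = log Q / ((log X)^{1/16} log P)` for `r = log Q/log P`, `ℓ = log X > 0`. [folklore] -/
theorem r_exp_eq {P Q X : ℝ} (hX : 0 < Real.log X) (hP : 0 < Real.log P) :
    Real.log Q / Real.log P * Real.exp (-(Real.log (Real.log X) / 16)) =
      Real.log Q / (Real.log X ^ (1 / 16 : ℝ) * Real.log P) := by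
  rw [Real.rpow_def_of_pos hX, Real.exp_neg]
  field_simp

/-! ### The second part, numerically -/

/-- `-(1/12) u log u + 24 u ≤ 24 e^{288}` for `u ≥ 1`. [folklore] -/
theorem aux_ulogu (u : ℝ) (hu : 1 ≤ u) : -(1 / 12) * u * Real.log u + 24 * u ≤ 24 * Real.exp 288 := by
  have hlogu : 0 ≤ Real.log u := Real.log_nonneg hu
  rcases le_or_gt u (Real.exp 288) with h | h
  · nlinarith
  · have : 288 < Real.log u := by simpa using Real.log_lt_log (Real.exp_pos 288) h
    nlinarith [Real.exp_pos 288]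

/-- `u⁴ e^{-u} ≤ 24` for `u ≥ 0`. [folklore] -/
theorem pow_four_mul_exp_neg_le {u : ℝ} (hu : 0 ≤ u) : u ^ 4 * Real.exp (-u) ≤ 24 := by
  have h := Real.sum_le_exp_of_nonneg hu 5
  simp only [Finset.sum_range_succ, Finset.sum_range_zero, Nat.factorial, pow_zero, Nat.cast_one, zero_add] at h
  norm_num at h
  rw [Real.exp_neg]
  have hexp := Real.exp_pos u
  rw [mul_inv_le_iff₀ hexp]
  nlinarith [pow_nonneg hu 2, pow_nonneg hu 3]

/-- `(log X)² ≤ (20/3)² X^{3/10}` for `X ≥ 1` (`log X ≤ X^{3/20} / (3/20)`). [folklore] -/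
theorem log_sq_le_rpow {X : ℝ} (hX : 1 ≤ X) : Real.log X ^ 2 ≤ (20 / 3) ^ 2 * X ^ (3 / 10 : ℝ) := by
  have h := Real.log_le_rpow_div (by linarith : (0:ℝ) ≤ X) (by norm_num : (0:ℝ) < 3 / 20)
  have h0 : 0 ≤ Real.log X := Real.log_nonneg hX
  have e : (X ^ (3 / 20 : ℝ)) ^ 2 = X ^ (3 / 10 : ℝ) := by
    rw [← Real.rpow_natCast, ← Real.rpow_mul (by linarith)]; norm_num
  calc Real.log X ^ 2 ≤ (X ^ (3 / 20 : ℝ) / (3 / 20)) ^ 2 := pow_le_pow_left₀ h0 h 2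
    _ = (20 / 3) ^ 2 * (X ^ (3 / 20 : ℝ)) ^ 2 := by ring
    _ = _ := by rw [e]

/-- **Case (b1)** of the second part: `1 < u = log X/log Q ≤ Q^{2/5}` and `log X < e^{(u/3) log u}`.
Rankin with `η = log u / log Q` gives `E ≤ 6 e^{C_M + 3 + C₀ + 24 e^{288}} · T₂`. [folklore] -/
theorem second_b1 {C_M : ℝ}
    (hCM : ∀ P Q : ℕ, 2 ≤ P → P ≤ Q → |∑ p ∈ (Finset.Icc P Q).filter Nat.Prime, (1 : ℝ) / p
        - (Real.log (Real.log Q) - Real.log (Real.log P))| ≤ C_M)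
    {f : ArithmeticFunction ℝ} (hf1 : ∀ n, |f n| ≤ 1) {P Q X t : ℝ} (hP : 2 ≤ P) (hPQ : P ≤ Q) (hQX : Q ≤ X)
    (hlogX : 1 ≤ Real.log X) {u : ℝ} (hu : u = Real.log X / Real.log Q) (hu1 : 1 < u)
    (huQ : Real.log u ≤ (2 / 5) * Real.log Q) (hT2 : Real.log X < Real.exp (u / 3 * Real.log u)) :
    ‖∑ n ∈ (Finset.Icc ⌈X⌉₊ ⌊2 * X⌋₊).filter (fun n => ⌊X ^ (3 / 4 : ℝ)⌋₊ < sPart (primesPQ P Q) n),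
        summandR f P Q t n‖ ≤
      6 * Real.exp (C_M + 3 + RankinComposed.C₀ + 24 * Real.exp 288) *
        (Real.log X * Real.exp (-(Real.log X / (3 * Real.log Q)) * Real.log (Real.log X / Real.log Q))) := by
  have hQ2 : 2 ≤ Q := hP.trans hPQ
  have hQ0 : 0 < Q := by linarith
  have hX1 : 1 ≤ X := by linarith
  have hX0 : 0 < X := by linarith
  have hlogQ : 0 < Real.log Q := Real.log_pos (by linarith)
  have hlogP : 0 < Real.log P := Real.log_pos (by linarith)
  have hlogu : 0 < Real.log u := Real.log_pos hu1
  set η : ℝ := Real.log u / Real.log Q with hη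
  have hη0 : 0 < η := div_pos hlogu hlogQ
  have hη25 : η ≤ 2 / 5 := by rw [hη, div_le_iff₀ hlogQ]; linarith
  have hE := second_part_rankin hf1 P Q t hX1 hη0 hη25
  refine hE.trans ?_
  -- identify `Q^η = u` and `X^{-3η/4} = e^{-(3/4) u log u}`
  have hlogXu : Real.log X = u * Real.log Q := by rw [hu]; field_simp
  have hQη : Q ^ η = u := by
    rw [Real.rpow_def_of_pos hQ0, hη, show Real.log Q * (Real.log u / Real.log Q) = Real.log u by field_simp,
      Real.exp_log (by linarith)]
  have hXη : X ^ (-(3 * η / 4)) = Real.exp (-(3 / 4) * (u * Real.log u)) := by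
    rw [Real.rpow_def_of_pos hX0, hlogXu, hη]; congr 1; field_simp
  -- the prime sum
  have hprime := sum_rpow_primesPQ_le (P := P) hQ2 hη0 (by linarith)
  rw [hQη] at hprime
  have hexpS := exp_SigAll_le hCM hP hPQ
  have hr : Real.log Q / Real.log P ≤ 2 * Real.log X := by
    rw [div_le_iff₀ hlogP]
    have hl2 : (0.6931471803 : ℝ) < Real.log 2 := Real.log_two_gt_d9
    have : Real.log 2 ≤ Real.log P := Real.log_le_log (by norm_num) hP
    have : Real.log Q ≤ Real.log X := Real.log_le_log hQ0 hQX
    nlinarith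
  have h1 : Real.exp (∑ p ∈ primesPQ P Q, (p : ℝ) ^ (-(1 - η)) + RankinComposed.C₀) ≤
      Real.exp C_M * (2 * Real.log X) * Real.exp (3 + 24 * u + RankinComposed.C₀) := by
    calc Real.exp (∑ p ∈ primesPQ P Q, (p : ℝ) ^ (-(1 - η)) + RankinComposed.C₀)
        ≤ Real.exp (SigAll (primesPQ P Q) + (3 + 24 * u + RankinComposed.C₀)) := Real.exp_le_exp.2 (by linarith)
      _ = Real.exp (SigAll (primesPQ P Q)) * Real.exp (3 + 24 * u + RankinComposed.C₀) := Real.exp_add _ _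
      _ ≤ _ := mul_le_mul_of_nonneg_right (hexpS.trans (mul_le_mul_of_nonneg_left hr (Real.exp_pos _).le))
          (Real.exp_pos _).le
  have h2 : 1 + Real.log (2 * X) ≤ 3 * Real.log X := by
    rw [Real.log_mul (by norm_num) hX0.ne']
    have : Real.log 2 < 1 := by have := Real.log_two_lt_d9; linarith
    linarith
  -- assemble: `E ≤ 3 log X · e^{-(3/4)u log u} · e^{C_M} 2 log X · e^{3 + 24u + C₀}`
  have hulogu : 0 ≤ u * Real.log u := by positivity
  have hmain : (1 + Real.log (2 * X)) * X ^ (-(3 * η / 4)) *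
      Real.exp (∑ p ∈ primesPQ P Q, (p : ℝ) ^ (-(1 - η)) + RankinComposed.C₀) ≤
      (3 * Real.log X) * Real.exp (-(3 / 4) * (u * Real.log u)) *
        (Real.exp C_M * (2 * Real.log X) * Real.exp (3 + 24 * u + RankinComposed.C₀)) := by
    rw [hXη]
    refine mul_le_mul (mul_le_mul_of_nonneg_right h2 (Real.exp_pos _).le) h1 (Real.exp_pos _).le (by positivity)
  refine hmain.trans ?_
  -- compare with `T₂ = log X · e^{-(u/3) log u}` using `log X < e^{(u/3) log u}` and `aux_ulogu`
  have hT2eq : Real.exp (-(Real.log X / (3 * Real.log Q)) * Real.log (Real.log X / Real.log Q)) =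
      Real.exp (-(u / 3 * Real.log u)) := by
    rw [← hu]; congr 1; rw [hu]; field_simp
  rw [hT2eq]
  have haux := aux_ulogu u hu1.le
  -- everything in exponentials: `(log X)² e^{-(3/4)uℓu} e^{24u} ≤ log X · e^{(1/3)uℓu} e^{-(3/4)uℓu} e^{24u}`
  have hlogX0 : 0 < Real.log X := by linarith
  have key : Real.log X * Real.exp (-(3 / 4) * (u * Real.log u)) * Real.exp (3 + 24 * u + RankinComposed.C₀) ≤
      Real.exp (3 + RankinComposed.C₀ + 24 * Real.exp 288) * Real.exp (-(u / 3 * Real.log u)) := by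
    calc Real.log X * Real.exp (-(3 / 4) * (u * Real.log u)) * Real.exp (3 + 24 * u + RankinComposed.C₀)
        ≤ Real.exp (u / 3 * Real.log u) * Real.exp (-(3 / 4) * (u * Real.log u)) * Real.exp (3 + 24 * u + RankinComposed.C₀) := by
          gcongr
      _ = Real.exp ((3 + RankinComposed.C₀ + (-(1 / 12) * u * Real.log u + 24 * u)) + (-(u / 3 * Real.log u))) := by
          rw [← Real.exp_add, ← Real.exp_add]; ring_nf
      _ ≤ Real.exp ((3 + RankinComposed.C₀ + 24 * Real.exp 288) + (-(u / 3 * Real.log u))) :=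
          Real.exp_le_exp.2 (by linarith)
      _ = _ := Real.exp_add _ _
  calc 3 * Real.log X * Real.exp (-(3 / 4) * (u * Real.log u)) *
        (Real.exp C_M * (2 * Real.log X) * Real.exp (3 + 24 * u + RankinComposed.C₀))
      = 6 * Real.exp C_M * Real.log X *
          (Real.log X * Real.exp (-(3 / 4) * (u * Real.log u)) * Real.exp (3 + 24 * u + RankinComposed.C₀)) := by ring
    _ ≤ 6 * Real.exp C_M * Real.log X *
          (Real.exp (3 + RankinComposed.C₀ + 24 * Real.exp 288) * Real.exp (-(u / 3 * Real.log u))) :=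
        mul_le_mul_of_nonneg_left key (by positivity)
    _ = 6 * (Real.exp C_M * Real.exp (3 + RankinComposed.C₀ + 24 * Real.exp 288)) *
          (Real.log X * Real.exp (-(u / 3 * Real.log u))) := by ring
    _ = _ := by rw [← Real.exp_add]; ring_nf

/-- `log X · X^{-3/10} ≤ (400/9) / log X` for `log X ≥ 1`. [folklore] -/
theorem log_mul_rpow_neg_le {X : ℝ} (hX : 1 ≤ X) (hlogX : 1 ≤ Real.log X) :
    Real.log X * X ^ (-(3 / 10 : ℝ)) ≤ (400 / 9) / Real.log X := by
  have hX0 : 0 < X := by linarith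
  have h := log_sq_le_rpow hX
  have hpos : 0 < X ^ (3 / 10 : ℝ) := by positivity
  rw [Real.rpow_neg hX0.le, le_div_iff₀ (by linarith)]
  calc Real.log X * (X ^ (3 / 10 : ℝ))⁻¹ * Real.log X = Real.log X ^ 2 / X ^ (3 / 10 : ℝ) := by
        field_simp
    _ ≤ (20 / 3) ^ 2 * X ^ (3 / 10 : ℝ) / X ^ (3 / 10 : ℝ) := div_le_div_of_nonneg_right h hpos.le
    _ = 400 / 9 := by field_simp; norm_num

/-- `1/log X ≤ 1/(log X)^{1/16}` for `log X ≥ 1`. [folklore] -/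
theorem inv_log_le_inv_rpow {X : ℝ} (hlogX : 1 ≤ Real.log X) :
    1 / Real.log X ≤ 1 / Real.log X ^ (1 / 16 : ℝ) := by
  refine one_div_le_one_div_of_le (by positivity) ?_
  calc Real.log X ^ (1 / 16 : ℝ) ≤ Real.log X ^ (1 : ℝ) := Real.rpow_le_rpow_of_exponent_le hlogX (by norm_num)
    _ = Real.log X := Real.rpow_one _

/-- **Case (b2-i)** of the second part: `Q < e^{400}`.  Rankin with `η = 2/5` and the crude
`∑_{p ∈ S} p^{-3/5} ≤ #S ≤ Q`: `E ≤ (400/3) e^{e^{400} + C₀} (log X)^{-1/16}`. [folklore] -/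
theorem second_b2i {f : ArithmeticFunction ℝ} (hf1 : ∀ n, |f n| ≤ 1) {P Q X t : ℝ} (hQ : 2 ≤ Q) (hQX : Q ≤ X)
    (hlogX : 1 ≤ Real.log X) (hQsmall : Q < Real.exp 400) :
    ‖∑ n ∈ (Finset.Icc ⌈X⌉₊ ⌊2 * X⌋₊).filter (fun n => ⌊X ^ (3 / 4 : ℝ)⌋₊ < sPart (primesPQ P Q) n),
        summandR f P Q t n‖ ≤
      (400 / 3) * Real.exp (Real.exp 400 + RankinComposed.C₀) * (1 / Real.log X ^ (1 / 16 : ℝ)) := by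
  have hX1 : 1 ≤ X := by linarith
  have hX0 : 0 < X := by linarith
  have hE := second_part_rankin hf1 P Q t hX1 (η := 2 / 5) (by norm_num) le_rfl
  refine hE.trans ?_
  -- the prime sum is at most `#S ≤ Q < e^{400}`
  have hS : ∑ p ∈ primesPQ P Q, (p : ℝ) ^ (-(1 - 2 / 5 : ℝ)) ≤ Real.exp 400 := by
    calc ∑ p ∈ primesPQ P Q, (p : ℝ) ^ (-(1 - 2 / 5 : ℝ)) ≤ ∑ p ∈ primesPQ P Q, (1 : ℝ) :=
          Finset.sum_le_sum fun p hp => Real.rpow_le_one_of_one_le_of_nonpos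
            (by exact_mod_cast (primesPQ_prime p hp).one_lt.le) (by norm_num)
      _ = #(primesPQ P Q) := by simp
      _ ≤ ⌊Q⌋₊ := by
          have : #(primesPQ P Q) ≤ #(Finset.Icc 1 ⌊Q⌋₊) := by
            refine Finset.card_le_card fun p hp => ?_
            rw [primesPQ, Finset.mem_filter, Finset.mem_Icc] at hp
            exact Finset.mem_Icc.2 ⟨hp.2.one_lt.le, hp.1.2⟩
          simpa using (show (#(primesPQ P Q) : ℝ) ≤ #(Finset.Icc 1 ⌊Q⌋₊) by exact_mod_cast this)
      _ ≤ Q := Nat.floor_le (by linarith)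
      _ ≤ Real.exp 400 := hQsmall.le
  have h2 : 1 + Real.log (2 * X) ≤ 3 * Real.log X := by
    rw [Real.log_mul (by norm_num) hX0.ne']
    have : Real.log 2 < 1 := by have := Real.log_two_lt_d9; linarith
    linarith
  have h3 : X ^ (-(3 * (2 / 5 : ℝ) / 4)) = X ^ (-(3 / 10 : ℝ)) := by norm_num
  rw [h3]
  have h4 := log_mul_rpow_neg_le hX1 hlogX
  have h5 := inv_log_le_inv_rpow hlogX
  calc (1 + Real.log (2 * X)) * X ^ (-(3 / 10 : ℝ)) * Real.exp (∑ p ∈ primesPQ P Q, (p : ℝ) ^ (-(1 - 2 / 5 : ℝ)) + RankinComposed.C₀)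
      ≤ (3 * Real.log X) * X ^ (-(3 / 10 : ℝ)) * Real.exp (Real.exp 400 + RankinComposed.C₀) := by
        refine mul_le_mul (mul_le_mul_of_nonneg_right h2 (by positivity)) (Real.exp_le_exp.2 (by linarith))
          (Real.exp_pos _).le (by positivity)
    _ = 3 * Real.exp (Real.exp 400 + RankinComposed.C₀) * (Real.log X * X ^ (-(3 / 10 : ℝ))) := by ring
    _ ≤ 3 * Real.exp (Real.exp 400 + RankinComposed.C₀) * ((400 / 9) / Real.log X) :=
        mul_le_mul_of_nonneg_left h4 (by positivity)
    _ = (400 / 3) * Real.exp (Real.exp 400 + RankinComposed.C₀) * (1 / Real.log X) := by ring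
    _ ≤ _ := mul_le_mul_of_nonneg_left h5 (by positivity)

/-- `(3/10) L − log L − 4 ≥ 1` for `L ≥ 400`. [folklore] -/
theorem aux_L {L : ℝ} (hL : 400 ≤ L) : 1 ≤ (3 / 10) * L - Real.log L - 4 := by
  have h := Real.log_le_rpow_div (by linarith : (0:ℝ) ≤ L) (by norm_num : (0:ℝ) < 1 / 2)
  set r := L ^ (1 / 2 : ℝ) with hr
  have hr2 : r ^ 2 = L := by
    rw [hr, ← Real.rpow_natCast, ← Real.rpow_mul (by linarith)]; norm_num
  have hr20 : 20 ≤ r := by nlinarith [Real.rpow_nonneg (by linarith : (0:ℝ) ≤ L) (1 / 2 : ℝ)]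
  have : Real.log L ≤ 2 * r := by have := h; field_simp at this; linarith
  nlinarith

/-- **Case (b2-ii)** of the second part: `Q ≥ e^{400}` and `u = log X/log Q > Q^{2/5}`.  Rankin with
`η = 2/5`, `∑_{p ∈ S} p^{-3/5} ≤ Q^{2/5} (log log Q + 4) ≤ u (log log Q + 4)`, so the exponent is
`≤ −u ((3/10) log Q − log log Q − 4) ≤ −u`, and `log X · e^{-u} (log X)^{1/16} ≤ (log X)² e^{-u} ≤ 150`:
`E ≤ 450 e^{C₀} (log X)^{-1/16}`. [folklore] -/
theorem second_b2ii {f : ArithmeticFunction ℝ} (hf1 : ∀ n, |f n| ≤ 1) {P Q X t : ℝ} (hQX : Q ≤ X)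
    (hlogX : 1 ≤ Real.log X) (hQbig : Real.exp 400 ≤ Q) {u : ℝ} (hu : u = Real.log X / Real.log Q)
    (huQ : (2 / 5) * Real.log Q < Real.log u) :
    ‖∑ n ∈ (Finset.Icc ⌈X⌉₊ ⌊2 * X⌋₊).filter (fun n => ⌊X ^ (3 / 4 : ℝ)⌋₊ < sPart (primesPQ P Q) n),
        summandR f P Q t n‖ ≤
      450 * Real.exp RankinComposed.C₀ * (1 / Real.log X ^ (1 / 16 : ℝ)) := by
  have hQ400 : (400 : ℝ) ≤ Real.exp 400 := by have := Real.add_one_le_exp (400:ℝ); linarith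
  have hQ2 : (2 : ℝ) ≤ Q := by linarith
  have hQ0 : 0 < Q := by linarith
  have hX1 : 1 ≤ X := by linarith
  have hX0 : 0 < X := by linarith
  have hlogQ : 400 ≤ Real.log Q := by
    have := Real.log_le_log (Real.exp_pos 400) hQbig; rwa [Real.log_exp] at this
  have hlogQ0 : 0 < Real.log Q := by linarith
  have hu1 : 1 ≤ u := by rw [hu, le_div_iff₀ hlogQ0, one_mul]; exact Real.log_le_log hQ0 hQX
  have hu0 : 0 < u := by linarith
  have hlogXu : Real.log X = u * Real.log Q := by rw [hu]; field_simp
  have hE := second_part_rankin hf1 P Q t hX1 (η := 2 / 5) (by norm_num) le_rfl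
  refine hE.trans ?_
  -- the prime sum: `∑_{p ∈ S} p^{-3/5} ≤ Q^{2/5} (log log Q + 4) ≤ u (log log Q + 4)`
  have hllQ : 0 ≤ Real.log (Real.log Q) := Real.log_nonneg (by linarith)
  have hQpow : Q ^ (2 / 5 : ℝ) ≤ u := by
    have : Real.log (Q ^ (2 / 5 : ℝ)) ≤ Real.log u := by rw [Real.log_rpow hQ0]; linarith
    exact (Real.log_le_log_iff (by positivity) hu0).1 this
  have hS : ∑ p ∈ primesPQ P Q, (p : ℝ) ^ (-(1 - 2 / 5 : ℝ)) ≤ u * (Real.log (Real.log Q) + 4) := by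
    have hpt : ∀ p ∈ primesPQ P Q, (p : ℝ) ^ (-(1 - 2 / 5 : ℝ)) ≤ Q ^ (2 / 5 : ℝ) * (1 / p) := by
      intro p hp
      have hp' := hp; rw [primesPQ, Finset.mem_filter, Finset.mem_Icc] at hp'
      have hp0 : (0 : ℝ) < p := by exact_mod_cast hp'.2.pos
      have hpQ : (p : ℝ) ≤ Q := (Nat.cast_le.2 hp'.1.2).trans (Nat.floor_le hQ0.le)
      rw [show (-(1 - 2 / 5 : ℝ)) = 2 / 5 + (-1) by norm_num, Real.rpow_add hp0, Real.rpow_neg_one, one_div]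
      exact mul_le_mul_of_nonneg_right (Real.rpow_le_rpow hp0.le hpQ (by norm_num)) (by positivity)
    have hsub : primesPQ P Q ⊆ Nat.primesLE ⌊Q⌋₊ := fun p hp => by
      rw [primesPQ, Finset.mem_filter, Finset.mem_Icc] at hp
      exact Nat.mem_primesLE.2 ⟨hp.1.2, hp.2⟩
    have hQ2' : 2 ≤ ⌊Q⌋₊ := Nat.le_floor (by simpa using hQ2)
    have hM := Literature.NumberTheory.LFunctions.MertensBound.sum_inv_prime_le ⌊Q⌋₊ hQ2'
    have hllQ' : Real.log (Real.log (⌊Q⌋₊ : ℝ)) ≤ Real.log (Real.log Q) := by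
      have h2 : (2:ℝ) ≤ ⌊Q⌋₊ := by exact_mod_cast hQ2'
      exact Real.log_le_log (Real.log_pos (by linarith)) (Real.log_le_log (by linarith) (Nat.floor_le hQ0.le))
    calc ∑ p ∈ primesPQ P Q, (p : ℝ) ^ (-(1 - 2 / 5 : ℝ)) ≤ ∑ p ∈ primesPQ P Q, Q ^ (2 / 5 : ℝ) * (1 / p) :=
          Finset.sum_le_sum hpt
      _ = Q ^ (2 / 5 : ℝ) * ∑ p ∈ primesPQ P Q, (1 : ℝ) / p := by rw [Finset.mul_sum]
      _ ≤ Q ^ (2 / 5 : ℝ) * ∑ p ∈ Nat.primesLE ⌊Q⌋₊, (1 : ℝ) / p :=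
          mul_le_mul_of_nonneg_left (Finset.sum_le_sum_of_subset_of_nonneg hsub fun _ _ _ => by positivity) (by positivity)
      _ ≤ Q ^ (2 / 5 : ℝ) * (Real.log (Real.log Q) + 4) := mul_le_mul_of_nonneg_left (by linarith) (by positivity)
      _ ≤ u * (Real.log (Real.log Q) + 4) := mul_le_mul_of_nonneg_right hQpow (by linarith)
  -- exponent bound
  have hauxL := aux_L hlogQ
  have hXpow : X ^ (-(3 * (2 / 5 : ℝ) / 4)) = Real.exp (-(3 / 10) * (u * Real.log Q)) := by
    rw [Real.rpow_def_of_pos hX0, hlogXu]; congr 1; ring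
  have hexp : X ^ (-(3 * (2 / 5 : ℝ) / 4)) * Real.exp (∑ p ∈ primesPQ P Q, (p : ℝ) ^ (-(1 - 2 / 5 : ℝ)) + RankinComposed.C₀) ≤
      Real.exp RankinComposed.C₀ * Real.exp (-u) := by
    rw [hXpow, ← Real.exp_add, ← Real.exp_add]
    refine Real.exp_le_exp.2 ?_
    nlinarith
  have h2 : 1 + Real.log (2 * X) ≤ 3 * Real.log X := by
    rw [Real.log_mul (by norm_num) hX0.ne']
    have : Real.log 2 < 1 := by have := Real.log_two_lt_d9; linarith
    linarith
  -- `log X · e^{-u} ≤ 150 / log X`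
  have hlogu : Real.log u ≤ u := by have := Real.log_le_sub_one_of_pos hu0; linarith
  have hlogXle : Real.log X ≤ (5 / 2) * u ^ 2 := by
    rw [hlogXu]
    have : Real.log Q < (5 / 2) * Real.log u := by linarith
    nlinarith
  have hkey : Real.log X * Real.exp (-u) ≤ 150 / Real.log X := by
    rw [le_div_iff₀ (by linarith)]
    have h4 := pow_four_mul_exp_neg_le hu0.le
    have : Real.log X * Real.exp (-u) * Real.log X = Real.log X ^ 2 * Real.exp (-u) := by ring
    rw [this]
    have hsq : Real.log X ^ 2 ≤ (25 / 4) * u ^ 4 := by nlinarith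
    nlinarith [Real.exp_pos (-u)]
  have h5 := inv_log_le_inv_rpow hlogX
  calc (1 + Real.log (2 * X)) * X ^ (-(3 * (2 / 5 : ℝ) / 4)) *
        Real.exp (∑ p ∈ primesPQ P Q, (p : ℝ) ^ (-(1 - 2 / 5 : ℝ)) + RankinComposed.C₀)
      = (1 + Real.log (2 * X)) * (X ^ (-(3 * (2 / 5 : ℝ) / 4)) *
        Real.exp (∑ p ∈ primesPQ P Q, (p : ℝ) ^ (-(1 - 2 / 5 : ℝ)) + RankinComposed.C₀)) := by ring
    _ ≤ (3 * Real.log X) * (Real.exp RankinComposed.C₀ * Real.exp (-u)) :=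
        mul_le_mul h2 hexp (by positivity) (by positivity)
    _ = 3 * Real.exp RankinComposed.C₀ * (Real.log X * Real.exp (-u)) := by ring
    _ ≤ 3 * Real.exp RankinComposed.C₀ * (150 / Real.log X) := mul_le_mul_of_nonneg_left hkey (by positivity)
    _ = 450 * Real.exp RankinComposed.C₀ * (1 / Real.log X) := by ring
    _ ≤ _ := mul_le_mul_of_nonneg_left h5 (by positivity)

/-! ### The two parts in terms of `T₁ = log Q/((log X)^{1/16} log P)` and `T₂ = log X · e^{-(u/3) log u}` -/

/-- The first printed term `T₁ = log Q / ((log X)^{1/16} log P)`. [cite: MatomakiRadziwillAnnals2016, Lemma 3] -/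
def T1 (X P Q : ℝ) : ℝ := Real.log Q / (Real.log X ^ (1 / 16 : ℝ) * Real.log P)

/-- The second printed term `T₂ = log X · exp(−(log X/(3 log Q)) log(log X/log Q))`. [cite: MatomakiRadziwillAnnals2016, Lemma 3] -/
def T2 (X Q : ℝ) : ℝ := Real.log X * Real.exp (-(Real.log X / (3 * Real.log Q)) * Real.log (Real.log X / Real.log Q))

/-- `T₁ ≥ (log X)^{-1/16} > 0` and `T₂ > 0` for `2 ≤ P ≤ Q`, `log X ≥ 1`. [folklore] -/
theorem inv_rpow_le_T1 {X P Q : ℝ} (hP : 2 ≤ P) (hPQ : P ≤ Q) (hlogX : 0 < Real.log X) :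
    1 / Real.log X ^ (1 / 16 : ℝ) ≤ T1 X P Q := by
  have hlogP : 0 < Real.log P := Real.log_pos (by linarith)
  have hPQ' : Real.log P ≤ Real.log Q := Real.log_le_log (by linarith) hPQ
  unfold T1
  rw [div_le_div_iff₀ (by positivity) (by positivity)]
  nlinarith [Real.rpow_pos_of_pos hlogX (1 / 16 : ℝ)]

/-- `T₂ > 0`. [folklore] -/
theorem T2_pos {X Q : ℝ} (hlogX : 1 ≤ Real.log X) : 0 < T2 X Q := by
  unfold T2; have : 0 < Real.log X := by linarith
  positivity

/-- **The second part, all cases**: `E ≤ K₂ (T₁ + T₂)` with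
`K₂ = 2 + 6 e^{C_M + 3 + C₀ + 24e^{288}} + (400/3) e^{e^{400} + C₀} + 450 e^{C₀}`. [folklore] -/
theorem second_part_numeric {C_M : ℝ}
    (hCM : ∀ P Q : ℕ, 2 ≤ P → P ≤ Q → |∑ p ∈ (Finset.Icc P Q).filter Nat.Prime, (1 : ℝ) / p
        - (Real.log (Real.log Q) - Real.log (Real.log P))| ≤ C_M)
    {f : ArithmeticFunction ℝ} (hf1 : ∀ n, |f n| ≤ 1) {P Q X t : ℝ} (hP : 2 ≤ P) (hPQ : P ≤ Q) (hQX : Q ≤ X)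
    (hlogX : 1 ≤ Real.log X) :
    ‖∑ n ∈ (Finset.Icc ⌈X⌉₊ ⌊2 * X⌋₊).filter (fun n => ⌊X ^ (3 / 4 : ℝ)⌋₊ < sPart (primesPQ P Q) n),
        summandR f P Q t n‖ ≤
      (2 + 6 * Real.exp (C_M + 3 + RankinComposed.C₀ + 24 * Real.exp 288) +
        (400 / 3) * Real.exp (Real.exp 400 + RankinComposed.C₀) + 450 * Real.exp RankinComposed.C₀) *
        (T1 X P Q + T2 X Q) := by
  classical
  set K_b1 := 6 * Real.exp (C_M + 3 + RankinComposed.C₀ + 24 * Real.exp 288) with hKb1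
  set K_b2i := (400 / 3) * Real.exp (Real.exp 400 + RankinComposed.C₀) with hKb2i
  set K_b2ii := 450 * Real.exp RankinComposed.C₀ with hKb2ii
  have hQ2 : 2 ≤ Q := hP.trans hPQ
  have hQ0 : 0 < Q := by linarith
  have hX1 : 1 ≤ X := by linarith
  have hlogQ : 0 < Real.log Q := Real.log_pos (by linarith)
  have hlogX0 : 0 < Real.log X := by linarith
  have hT1 := inv_rpow_le_T1 hP hPQ hlogX0
  have hT1pos : 0 < T1 X P Q := lt_of_lt_of_le (by positivity) hT1
  have hT2pos := T2_pos (Q := Q) hlogX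
  have hK0 : 0 ≤ K_b1 ∧ 0 ≤ K_b2i ∧ 0 ≤ K_b2ii := ⟨by positivity, by positivity, by positivity⟩
  set E := ‖∑ n ∈ (Finset.Icc ⌈X⌉₊ ⌊2 * X⌋₊).filter (fun n => ⌊X ^ (3 / 4 : ℝ)⌋₊ < sPart (primesPQ P Q) n),
        summandR f P Q t n‖ with hEdef
  have hsum : ∀ {K : ℝ}, 0 ≤ K → K ≤ 2 + K_b1 + K_b2i + K_b2ii →
      ∀ {B : ℝ}, E ≤ K * B → 0 ≤ B → B ≤ T1 X P Q + T2 X Q →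
        E ≤ (2 + K_b1 + K_b2i + K_b2ii) * (T1 X P Q + T2 X Q) := by
    intro K hK hKle B hE hB hBle
    calc E ≤ K * B := hE
      _ ≤ (2 + K_b1 + K_b2i + K_b2ii) * (T1 X P Q + T2 X Q) := mul_le_mul hKle hBle hB (by linarith)
  by_cases hcaseA : 1 ≤ T2 X Q
  · -- trivial bound
    have hE2 : E ≤ 2 * T2 X Q := (norm_sum_filter_summandR_le_two hf1 P Q t hX1 _).trans (by linarith)
    exact hsum (by norm_num) (by linarith [hK0.1, hK0.2.1, hK0.2.2]) hE2 hT2pos.le (by linarith)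
  · push Not at hcaseA
    set u := Real.log X / Real.log Q with hu
    have hu1 : 1 ≤ u := by rw [hu, le_div_iff₀ hlogQ, one_mul]; exact Real.log_le_log hQ0 hQX
    -- `T₂ < 1 ≤ log X` forces `log u > 0`
    have hT2' : Real.log X < Real.exp (u / 3 * Real.log u) := by
      have h := hcaseA
      unfold T2 at h
      have e : -(Real.log X / (3 * Real.log Q)) * Real.log (Real.log X / Real.log Q) = -(u / 3 * Real.log u) := by
        rw [hu]; ring
      rw [e, Real.exp_neg] at h
      rwa [mul_inv_lt_iff₀ (Real.exp_pos _), one_mul] at h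
    have hu1' : 1 < u := by
      by_contra h; push Not at h
      have hu_eq : u = 1 := le_antisymm h hu1
      rw [hu_eq, Real.log_one, mul_zero, Real.exp_zero] at hT2'
      linarith
    by_cases hcaseB : Real.log u ≤ (2 / 5) * Real.log Q
    · have hE := second_b1 hCM hf1 hP hPQ hQX hlogX hu hu1' hcaseB hT2' (t := t)
      exact hsum hK0.1 (by linarith [hK0.2.1, hK0.2.2]) hE hT2pos.le
        (by show T2 X Q ≤ T1 X P Q + T2 X Q; linarith)
    · push Not at hcaseB
      by_cases hcaseC : Q < Real.exp 400
      · have hE := second_b2i hf1 (P := P) (t := t) hQ2 hQX hlogX hcaseC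
        exact hsum hK0.2.1 (by linarith [hK0.1, hK0.2.2]) hE (by positivity) (by linarith)
      · push Not at hcaseC
        have hE := second_b2ii hf1 (P := P) (t := t) hQX hlogX hcaseC hu hcaseB
        exact hsum hK0.2.2 (by linarith [hK0.1, hK0.2.1]) hE (by positivity) (by linarith)

/-- **The first part, numerically**: for `log X ≥ 4¹⁶`, `x₀ ≤ Y_*`, `3X^A ≤ Y_*^{A'}`,
`(log X)^{1/16} ≤ t ≤ X^A`: `‖∑_{s_S(n) ≤ X^{3/4}} F(n)‖ ≤ K₁ T₁` with
`K₁ = 30 C_H e^{C₀ + 2C_M + (39/80)(log 5 + C_M) + (39/160)|C_D|} + 114 C_H e^{C₀ + C_M}`. [folklore] -/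
theorem first_part_numeric {C_H : ℝ} (hC_H : 0 ≤ C_H)
    (hH : ∀ g : ArithmeticFunction ℂ, g.IsMultiplicative → (∀ n, ‖g n‖ ≤ 1) →
      ∀ x T M₀ : ℝ, 3 ≤ x → 1 ≤ T → (∀ y : ℝ, |y| ≤ 2 * T → M₀ ≤ Msum g x y) →
        ‖∑ n ∈ Icc 1 ⌊x⌋₊, g n‖ ≤
          x * (C_H * Real.exp (-(39 / 40) * M₀) + C_H * (1 / T + Real.log (Real.log x) / Real.log x)))
    {A' x₀ C_D : ℝ}
    (hD : ∀ x : ℝ, x₀ ≤ x → ∀ τ : ℝ, 2 ≤ |τ| → |τ| ≤ x ^ A' →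
      Real.log (Real.log x) / 3 - C_D ≤ pretentiousDistSq 1 (fun n : ℕ => (n : ℂ) ^ ((τ : ℂ) * I)) x)
    {C_M : ℝ}
    (hCM : ∀ P Q : ℕ, 2 ≤ P → P ≤ Q → |∑ p ∈ (Finset.Icc P Q).filter Nat.Prime, (1 : ℝ) / p
        - (Real.log (Real.log Q) - Real.log (Real.log P))| ≤ C_M)
    {f : ArithmeticFunction ℝ} (hf : f.IsMultiplicative) (hf1 : ∀ n, |f n| ≤ 1)
    {P Q X t A : ℝ} (hP : 2 ≤ P) (hPQ : P ≤ Q) (hQX : Q ≤ X) (hlogX : (4 : ℝ) ^ 16 ≤ Real.log X)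
    (hYx₀ : x₀ ≤ Ystar X) (hXA : 3 * X ^ A ≤ (Ystar X) ^ A')
    (ht : Real.log X ^ (1 / 16 : ℝ) ≤ t) (htA : t ≤ X ^ A) (ht0A : 0 ≤ A) :
    ‖∑ n ∈ (Finset.Icc ⌈X⌉₊ ⌊2 * X⌋₊).filter (fun n => sPart (primesPQ P Q) n ≤ ⌊X ^ (3 / 4 : ℝ)⌋₊),
        summandR f P Q t n‖ ≤
      (30 * C_H * Real.exp (RankinComposed.C₀ + 2 * C_M + (39 / 80) * (Real.log 5 + C_M) + (39 / 160) * |C_D|) +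
        114 * C_H * Real.exp (RankinComposed.C₀ + C_M)) * T1 X P Q := by
  have hCM0 : 0 ≤ C_M := le_trans (abs_nonneg _) (hCM 2 2 le_rfl le_rfl)
  have h416 : (4 : ℝ) ^ 16 = 4294967296 := by norm_num
  set ℓ := Real.log X with hℓ
  have hℓ1 : 1 ≤ ℓ := by linarith
  have hℓ0 : 0 < ℓ := by linarith
  have hX1 : 1 < X := by
    by_contra h; push Not at h
    have : Real.log X ≤ 0 := Real.log_nonpos (by linarith [hP, hPQ, hQX]) h
    linarith
  have hX0 : 0 < X := by linarith
  have hXexp : X = Real.exp ℓ := by rw [hℓ, Real.exp_log hX0]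
  -- `log Y_* = ℓ/4 − log 2 ≥ ℓ/5`, `Y_* ≥ 4`
  have hlog2 : Real.log 2 < 1 := by have := Real.log_two_lt_d9; linarith
  have hYdef : Ystar X = X ^ (1 / 4 : ℝ) / 2 := rfl
  have hlogY : Real.log (Ystar X) = ℓ / 4 - Real.log 2 := by
    rw [hYdef, Real.log_div (by positivity) (by norm_num), Real.log_rpow hX0]; ring
  have hy : ℓ / 5 ≤ Real.log (Ystar X) := by rw [hlogY]; linarith
  have hY4 : 4 ≤ Ystar X := by
    have h1 : Real.log 4 ≤ Real.log (Ystar X) := by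
      rw [hlogY, show (4:ℝ) = 2 ^ 2 by norm_num, Real.log_pow]; push_cast; linarith
    exact (Real.log_le_log_iff (by norm_num) (by rw [hYdef]; positivity)).1 h1
  have hYX : Ystar X ≤ X := by
    rw [hYdef]
    have : X ^ (1 / 4 : ℝ) ≤ X := by
      calc X ^ (1 / 4 : ℝ) ≤ X ^ (1 : ℝ) := Real.rpow_le_rpow_of_exponent_le hX1.le (by norm_num)
        _ = X := Real.rpow_one X
    linarith [Real.rpow_nonneg hX0.le (1 / 4 : ℝ)]
  -- `t ≥ 4`
  have ht4 : 4 ≤ t := by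
    refine le_trans ?_ ht
    have e : ((4 : ℝ) ^ (16 : ℕ)) ^ (1 / 16 : ℝ) = 4 := by
      rw [show (1 / 16 : ℝ) = ((16 : ℕ) : ℝ)⁻¹ by norm_num]
      exact Real.pow_rpow_inv_natCast (by norm_num) (by norm_num)
    calc (4 : ℝ) = ((4 : ℝ) ^ (16 : ℕ)) ^ (1 / 16 : ℝ) := e.symm
      _ ≤ ℓ ^ (1 / 16 : ℝ) := Real.rpow_le_rpow (by positivity) (by exact_mod_cast hlogX) (by norm_num)
  have hfirst := first_part_le hC_H hH hD hf hf1 (P := P) (Q := Q) hX1.le hYx₀ hY4 hXA ht4 htA ht0A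
  refine hfirst.trans ?_
  -- the ingredients of the three terms
  set S := primesPQ P Q with hSdef
  have hlogP : 0 < Real.log P := Real.log_pos (by linarith)
  have hr : 1 ≤ Real.log Q / Real.log P := by
    rw [le_div_iff₀ hlogP, one_mul]; exact Real.log_le_log (by linarith) hPQ
  have hs := exp_SigAll_le hCM hP hPQ
  have htail : SigAll S - Sig S (Ystar X) ≤ Real.log 5 + C_M := by
    have h1 := SigAll_sub_Sig_le' hCM (P := P) (Q := Q) (Y := Ystar X) (by linarith)
    have hmax : Real.log (Real.log (max Q (Ystar X))) ≤ Real.log ℓ := by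
      have hm : max Q (Ystar X) ≤ X := max_le hQX hYX
      have hm2 : (2 : ℝ) ≤ max Q (Ystar X) := le_trans (hP.trans hPQ) (le_max_left _ _)
      exact Real.log_le_log (Real.log_pos (by linarith)) (Real.log_le_log (by linarith) hm)
    have hmin : Real.log ℓ - Real.log 5 ≤ Real.log (Real.log (Ystar X)) := by
      rw [← Real.log_div hℓ0.ne' (by norm_num)]
      exact Real.log_le_log (by positivity) hy
    linarith
  have htexp : Real.exp (Real.log ℓ / 16) ≤ t := by
    have : Real.exp (Real.log ℓ / 16) = ℓ ^ (1 / 16 : ℝ) := by rw [Real.rpow_def_of_pos hℓ0]; ring_nf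
    rw [this]; exact ht
  have hL0 : 0 ≤ Real.log (Real.log (2 * X)) := by
    refine Real.log_nonneg ?_
    rw [Real.log_mul (by norm_num) hX0.ne']; linarith [Real.log_pos one_lt_two]
  have hL : Real.log (Real.log (2 * X)) ≤ 3 * Real.exp (Real.log ℓ / 2) := by
    have h := loglog_two_mul_le hX1.le hℓ1
    have e : ℓ ^ (1 / 2 : ℝ) = Real.exp (Real.log ℓ / 2) := by rw [Real.rpow_def_of_pos hℓ0]; ring_nf
    rw [← e]; exact h
  have hA := termA_le (C0 := RankinComposed.C₀) (C_D := C_D) hC_H hCM0 hℓ1 hy hr hs htail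
  have hB := termB_le (C0 := RankinComposed.C₀) (C_M := C_M) hC_H hr hs htexp
  have hC := termC_le (C0 := RankinComposed.C₀) (C_M := C_M) hC_H hℓ1 hy hr hs hL0 hL
  have hT1 : Real.log Q / Real.log P * Real.exp (-(Real.log ℓ / 16)) = T1 X P Q := by
    rw [hℓ]; exact r_exp_eq (by rw [← hℓ]; exact hℓ0) hlogP
  -- distribute and add
  have hM0 : M0 C_D S X = (1 / 4) * (Real.log (Real.log (Ystar X)) / 3 - C_D) + (1 / 2) * Sig S (Ystar X) := rfl
  rw [hM0]
  have e : Real.exp (SigAll S + RankinComposed.C₀) *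
      (6 * (C_H * Real.exp (-(39 / 40) * ((1 / 4) * (Real.log (Real.log (Ystar X)) / 3 - C_D) + (1 / 2) * Sig S (Ystar X))) +
        C_H * (4 / t + Real.log (Real.log (2 * X)) / Real.log (Ystar X))))
      = Real.exp (SigAll S + RankinComposed.C₀) *
          (6 * (C_H * Real.exp (-(39 / 40) * ((1 / 4) * (Real.log (Real.log (Ystar X)) / 3 - C_D) + (1 / 2) * Sig S (Ystar X)))))
        + Real.exp (SigAll S + RankinComposed.C₀) * (6 * (C_H * (4 / t)))
        + Real.exp (SigAll S + RankinComposed.C₀) * (6 * (C_H * (Real.log (Real.log (2 * X)) / Real.log (Ystar X)))) := by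
    ring
  rw [e, ← hT1]
  have hT1pos : 0 ≤ Real.log Q / Real.log P * Real.exp (-(Real.log ℓ / 16)) := by positivity
  nlinarith [hA, hB, hC, hT1pos, Real.exp_pos (RankinComposed.C₀ + C_M),
    Real.exp_pos (RankinComposed.C₀ + 2 * C_M + (39 / 80) * (Real.log 5 + C_M) + (39 / 160) * |C_D|)]

/-! ### Thresholds and the final assembly -/

/-- The large-`X` regime: for `X ≥ X₀ = max(e^{4¹⁶}, (2x₀)⁴, 3·2^{4A+8})` one has `log X ≥ 4¹⁶`, `Y_* ≥ x₀` and
`3 X^A ≤ Y_*^{4A+8}`. [folklore] -/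
theorem threshold {x₀ A X : ℝ} (hx₀ : 0 ≤ x₀)
    (hX : max (Real.exp ((4 : ℝ) ^ 16)) (max ((2 * x₀) ^ 4) (3 * (2 : ℝ) ^ (4 * A + 8))) ≤ X) :
    (4 : ℝ) ^ 16 ≤ Real.log X ∧ x₀ ≤ Ystar X ∧ 3 * X ^ A ≤ (Ystar X) ^ (4 * A + 8) := by
  have h1 : Real.exp ((4 : ℝ) ^ 16) ≤ X := le_trans (le_max_left _ _) hX
  have h2 : (2 * x₀) ^ 4 ≤ X := le_trans (le_trans (le_max_left _ _) (le_max_right _ _)) hX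
  have h3 : 3 * (2 : ℝ) ^ (4 * A + 8) ≤ X := le_trans (le_trans (le_max_right _ _) (le_max_right _ _)) hX
  have hX0 : 0 < X := lt_of_lt_of_le (Real.exp_pos _) h1
  have hX1 : 1 ≤ X := le_trans (by have := Real.one_le_exp (show (0:ℝ) ≤ 4 ^ 16 by positivity); exact this) h1
  refine ⟨?_, ?_, ?_⟩
  · have := Real.log_le_log (Real.exp_pos _) h1; rwa [Real.log_exp] at this
  · show x₀ ≤ X ^ (1 / 4 : ℝ) / 2
    have e : ((2 * x₀) ^ (4 : ℕ)) ^ (1 / 4 : ℝ) = 2 * x₀ := by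
      rw [show (1 / 4 : ℝ) = ((4 : ℕ) : ℝ)⁻¹ by norm_num]
      exact Real.pow_rpow_inv_natCast (by positivity) (by norm_num)
    have : 2 * x₀ ≤ X ^ (1 / 4 : ℝ) := by
      rw [← e]; exact Real.rpow_le_rpow (by positivity) h2 (by norm_num)
    linarith
  · show 3 * X ^ A ≤ (X ^ (1 / 4 : ℝ) / 2) ^ (4 * A + 8)
    rw [Real.div_rpow (by positivity) (by norm_num), ← Real.rpow_mul hX0.le,
      show (1 / 4 : ℝ) * (4 * A + 8) = A + 2 by ring, Real.rpow_add hX0, Real.rpow_two]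
    have h2pow : 0 < (2 : ℝ) ^ (4 * A + 8) := by positivity
    rw [le_div_iff₀ h2pow]
    have hXA : 0 < X ^ A := by positivity
    have hXX : 3 * (2 : ℝ) ^ (4 * A + 8) ≤ X ^ 2 := by nlinarith
    calc 3 * X ^ A * (2 : ℝ) ^ (4 * A + 8) = X ^ A * (3 * (2 : ℝ) ^ (4 * A + 8)) := by ring
      _ ≤ X ^ A * X ^ 2 := mul_le_mul_of_nonneg_left hXX hXA.le

/-- The sum `R(1 + it)` of the fact is `∑ F(n)`; split by the size of the `S`-part. [folklore] -/
theorem sum_split (f : ArithmeticFunction ℝ) (P Q t X : ℝ) (Zn : ℕ) :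
    ∑ n ∈ Finset.Icc ⌈X⌉₊ ⌊2 * X⌋₊, summandR f P Q t n =
      ∑ n ∈ (Finset.Icc ⌈X⌉₊ ⌊2 * X⌋₊).filter (fun n => sPart (primesPQ P Q) n ≤ Zn), summandR f P Q t n +
      ∑ n ∈ (Finset.Icc ⌈X⌉₊ ⌊2 * X⌋₊).filter (fun n => Zn < sPart (primesPQ P Q) n), summandR f P Q t n := by
  classical
  rw [← Finset.sum_filter_add_sum_filter_not _ (fun n => sPart (primesPQ P Q) n ≤ Zn)]
  congr 1
  refine Finset.sum_congr (Finset.filter_congr fun n _ => by simp [not_le]) fun _ _ => rfl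

end MatomakiRadziwillL3

open MatomakiRadziwillL3 in
/-- **Matomäki–Radziwiłł 2016, Lemma 3 — discharged from Granville–Soundararajan's Theorem 1 and Ford's
bound for `ζ(1 + it)`.**  For every `A > 0` there is `C` such that for every real multiplicative `f` with
`|f| ≤ 1` and all `2 ≤ P ≤ Q ≤ X`, `(log X)^{1/16} ≤ t ≤ X^A`,
`|R(1+it)| ≤ C (log Q/((log X)^{1/16} log P) + log X · exp(−(log X/(3 log Q)) log(log X/log Q)))`,
`R(s) = ∑_{X ≤ n ≤ 2X} f(n) n^{-s}/(#{p ∈ [P,Q] : p ∣ n} + 1)`.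
Proof (the printed one, MR §2): split `n = n₁ n₂` by the `S = 𝒫 ∩ [P,Q]`-part `n₁ = s_S(n)`; for
`n₁ ≤ X^{3/4}` apply Halász in the form of MR's Lemma 1 (`MatomakiRadziwillL3.halasz_of_GS`, from
`GranvilleSoundararajan2003_theorem1`) to the sifted twist `G = f 1_{(n,∏S)=1} n^{-it}` on each fibre, its
distance being `≥ ¼ 𝔻(1, n^{2i(t+y)})² + ½ ∑_{p ∈ S, p ≤ y} 1/p` (`Msum_siftedTwist_ge`) with MR Lemma 2
(`PretentiousFord.pretentiousDistSq_one_twist_ge`, from `zeta_bound_ford`) — the sifting gain offsetting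
`∑_{n₁} 1/n₁ ≤ ∏_{p ∈ S}(1 − 1/p)⁻¹`; for `n₁ > X^{3/4}` Rankin's trick over `S`-composed numbers
(`RankinComposedTail.lean`) or the trivial bound, according to the size of `u = log X/log Q`.
[cite: MatomakiRadziwillAnnals2016, Lemma 3] -/
theorem MatomakiRadziwill2016_lemma3_of_GS_ford
    (hGS : Literature.NumberTheory.LFunctions.GranvilleSoundararajan.GranvilleSoundararajan2003_theorem1)
    (hF : Literature.NumberTheory.LFunctions.zeta_bound_ford) :
    MatomakiRadziwill2016_lemma3 := by
  intro A hA
  obtain ⟨C_H, hC_H, hH⟩ := halasz_of_GS hGS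
  obtain ⟨x₀, C_D, hx₀, hD⟩ :=
    Literature.NumberTheory.LFunctions.PretentiousFord.pretentiousDistSq_one_twist_ge hF (A := 4 * A + 8) (by linarith)
  obtain ⟨C_M, hCM⟩ := RankinComposed.exists_abs_sum_inv_primes_Icc_sub_le
  set K₁ : ℝ := 30 * C_H * Real.exp (RankinComposed.C₀ + 2 * C_M + (39 / 80) * (Real.log 5 + C_M) + (39 / 160) * |C_D|) +
    114 * C_H * Real.exp (RankinComposed.C₀ + C_M) with hK₁
  set K₂ : ℝ := 2 + 6 * Real.exp (C_M + 3 + RankinComposed.C₀ + 24 * Real.exp 288) +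
    (400 / 3) * Real.exp (Real.exp 400 + RankinComposed.C₀) + 450 * Real.exp RankinComposed.C₀ with hK₂
  set X₀ : ℝ := max (Real.exp ((4 : ℝ) ^ 16)) (max ((2 * x₀) ^ 4) (3 * (2 : ℝ) ^ (4 * A + 8))) with hX₀
  have hK₁0 : 0 ≤ K₁ := by positivity
  have hK₂0 : 0 ≤ K₂ := by positivity
  have hX₀1 : Real.exp ((4:ℝ) ^ 16) ≤ X₀ := le_max_left _ _
  have hlogX₀ : (1 : ℝ) ≤ Real.log X₀ := by
    have := Real.log_le_log (Real.exp_pos _) hX₀1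
    rw [Real.log_exp] at this
    have : (1:ℝ) ≤ 4 ^ 16 := by norm_num
    linarith
  refine ⟨2 * Real.log X₀ ^ (1 / 16 : ℝ) + K₁ + K₂, ?_⟩
  intro f hf hf1 X P Q t hP hPQ hQX ht htA
  show ‖∑ n ∈ Finset.Icc ⌈X⌉₊ ⌊2 * X⌋₊, summandR f P Q t n‖ ≤
    (2 * Real.log X₀ ^ (1 / 16 : ℝ) + K₁ + K₂) * (T1 X P Q + T2 X Q)
  have hX2 : 2 ≤ X := (hP.trans hPQ).trans hQX
  have hlogX : 0 < Real.log X := Real.log_pos (by linarith)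
  have hT1 := inv_rpow_le_T1 hP hPQ hlogX
  have hT1pos : 0 < T1 X P Q := lt_of_lt_of_le (by positivity) hT1
  have hT2 : 0 ≤ T2 X Q := by unfold T2; positivity
  by_cases hlarge : X₀ ≤ X
  · obtain ⟨hℓ, hYx₀, hXA⟩ := threshold (by linarith) (hX₀ ▸ hlarge)
    have hℓ1 : 1 ≤ Real.log X := le_trans (by norm_num) hℓ
    rw [sum_split f P Q t X ⌊X ^ (3 / 4 : ℝ)⌋₊]
    refine (norm_add_le _ _).trans ?_
    have h1 := first_part_numeric hC_H hH hD hCM hf hf1 hP hPQ hQX hℓ hYx₀ hXA ht htA hA.le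
    have h2 := second_part_numeric hCM hf1 hP hPQ hQX hℓ1 (t := t)
    rw [← hK₁] at h1; rw [← hK₂] at h2
    have hL0 : 0 ≤ 2 * Real.log X₀ ^ (1 / 16 : ℝ) := by positivity
    have h5 : K₁ * T1 X P Q + K₂ * (T1 X P Q + T2 X Q) ≤
        (2 * Real.log X₀ ^ (1 / 16 : ℝ) + K₁ + K₂) * (T1 X P Q + T2 X Q) := by
      nlinarith [mul_nonneg hL0 hT1pos.le, mul_nonneg hL0 hT2, mul_nonneg hK₁0 hT2]
    linarith
  · -- small `X`: the trivial bound
    push Not at hlarge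
    have hR : ‖∑ n ∈ Finset.Icc ⌈X⌉₊ ⌊2 * X⌋₊, summandR f P Q t n‖ ≤ 2 := by
      have := norm_sum_filter_summandR_le_two hf1 P Q t (by linarith : (1:ℝ) ≤ X) (fun _ => True)
      simpa using this
    have hmono : Real.log X ^ (1 / 16 : ℝ) ≤ Real.log X₀ ^ (1 / 16 : ℝ) :=
      Real.rpow_le_rpow hlogX.le (Real.log_le_log (by linarith) hlarge.le) (by norm_num)
    have h3 : (2 : ℝ) ≤ 2 * Real.log X₀ ^ (1 / 16 : ℝ) * T1 X P Q := by
      have hpos : 0 < Real.log X ^ (1 / 16 : ℝ) := by positivity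
      have : 1 ≤ Real.log X₀ ^ (1 / 16 : ℝ) * (1 / Real.log X ^ (1 / 16 : ℝ)) := by
        rw [mul_one_div, le_div_iff₀ hpos, one_mul]; exact hmono
      nlinarith [mul_le_mul_of_nonneg_left hT1 (show 0 ≤ Real.log X₀ ^ (1 / 16 : ℝ) by positivity)]
    have h4 : 2 * Real.log X₀ ^ (1 / 16 : ℝ) * T1 X P Q ≤
        (2 * Real.log X₀ ^ (1 / 16 : ℝ) + K₁ + K₂) * (T1 X P Q + T2 X Q) := by
      have hL0 : 0 ≤ 2 * Real.log X₀ ^ (1 / 16 : ℝ) := by positivity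
      nlinarith [mul_nonneg hK₁0 hT1pos.le, mul_nonneg hK₂0 hT1pos.le, mul_nonneg hL0 hT2,
        mul_nonneg hK₁0 hT2, mul_nonneg hK₂0 hT2]
    linarith


end Literature.NumberTheory.Sieve
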